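import Literature.Geometry.Riemannian.GeneralizedCylinderMeanCurvature
import Literature.Geometry.Lorentzian.CurvatureNaturality
import Literature.Geometry.Lorentzian.HypersurfaceHessian
import Literature.Geometry.Lorentzian.PartialVelocityLift
import Literature.Geometry.Riemannian.ShrinkerSplittingAtInfinity
import HarnessLib

/-!
# Static generalized cylinders `(N × ℝ, h + dt²)`: totally geodesic slices, `Ric = Ric_h ⊕ 0`,
# `R_{h + dt²}(z, t) = R_h(z)` (O'Neill 1983, Ch. 3, Cor. 3.58; Ch. 7, Cor. 7.43), and the splitting
# `F = φ + (t - t₀)²/4` of the potential of a gradient shrinker on such a cylinder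
# (Haslhofer–Müller 2011, §2)

Topic `Literature/Geometry/Riemannian`; the proof file (sibling `…Proofs.lean`) of the named fact
`Literature.Geometry.Riemannian.shrinkerSplittingAtInfinity_four`
(`ShrinkerSplittingAtInfinity.lean`), built bottom-up. This first brick is Step 5/7 of the
printed chain recorded there: the limit shrinker splits isometrically as a Riemannian product
`X = N × ℝ` with metric `h + dt²` (Naber 2010, Lemma 4.1), and the exported conclusion (N2) of the
fact compares the scalar curvature of `(M, g)` with `R_h ∘ pr₁` — which is the scalar curvature
of the product, `R_{h + dt²}(z, t) = R_h(z)` (O'Neill 1983, Ch. 3, Cor. 3.58: the curvature of a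
semi-Riemannian product is the sum of the lifted curvatures, zero on mixed pairs; Ch. 7,
Cor. 7.43 with warping function `f ≡ 1`).

In the tree's language (the generalized cylinders of `GeneralizedCylinderGeodesics.lean`,
Bär–Gauduchon–Moroianu 2005) a Riemannian product with a line is a metric `G` on `N × ℝ`
(model `I'.prod 𝓘(ℝ, ℝ)`, tangent vectors `(v, s)`) with the **cylinder property**
`G((v,a),(w,b)) = G((v,0),(w,0)) + ab` (`hcyl`) which is moreover **static**: the slice metrics
`g_t(v, w) = G_{(z,t)}((v,0),(w,0))` do not depend on `t` (`hstat`). This file proves, in every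
dimension:

* `staticCyl_secondFundamentalForm_eq_zero` — the slices `ι_t : z ↦ (z, t)` are **totally
  geodesic**, `K_t = 0` (`ġ_t = 2K_t`, `hasDerivAt_cyl_val`, and `ġ_t = 0`; O'Neill 1983, Ch. 7,
  Cor. 7.36: "the leaves `B × q` of a warped product are totally geodesic");
* `staticCyl_meanCurvature_eq_zero`, `staticCyl_normSq_secondFundamentalForm_eq_zero` —
  hence `H_t = 0`, `|K_t|² = 0`;
* `staticCyl_inducedMetric_eq` — all slices carry the same induced metric `h = ι_t^* G`;
* `staticCyl_scalarCurvature_eq` — **`R_G(z, t) = R_h(z)`** (O'Neill 1983, Ch. 3, Cor. 3.58 /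
  Ch. 7, Cor. 7.43 (1)–(3) with `f ≡ 1`, traced), from the generalized-cylinder formula
  `R_G = R_{g_t} - |K_t|² - H_t² - 2∂_t H_t` (`cyl_scalarCurvature_eq`, Bär–Gauduchon–Moroianu
  2005, Prop. 4.1) with `K ≡ 0`;
* `staticCyl_normalDerivAlong_eq_zero` — `∂_t` is parallel along the slices, `D_v ∂_t = 0`
  (O'Neill 1983, Ch. 3, Prop. 3.56 (3));
* `staticCyl_ricci_inr_inr`, `staticCyl_ricci_inr_inl`, `staticCyl_ricci_inl_inl` — **the Ricci
  tensor is `Ric_h ⊕ 0`**: `Ric(∂_t, ∂_t) = 0` (Raychaudhuri equation with `K ≡ 0`),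
  `Ric(∂_t, (v,0)) = 0` (the reflection `t ↦ 2t₀ - t` is an isometry; naturality of `Ric`,
  `ricci_comap_apply`), `Ric((v,0),(w,0)) = Ric_h(v,w)` (Gauss equation with `K ≡ 0` in an
  adapted orthogonal frame, and `G(R(∂_t,u)∂_t, u) = 0` from the Riccati identity,
  `staticCyl_val_riemann_inr_inl_inr_self`) — O'Neill 1983, Ch. 3, Cor. 3.58; Ch. 7,
  Cor. 7.43 (1)–(3) with `f ≡ 1`;
* `gauss_equation_pair` — the Gauss equation `(f^*g)(R(X,Y)Y,X) = g(R̄(df X,df Y)df Y, df X)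
  + (K(X,X)K(Y,Y) - K(X,Y)K(Y,X))/ε` for an ARBITRARY pair of tangent vectors of an immersed
  hypersurface (O'Neill 1983, Ch. 4, Thm. 4.5), from the tree's coordinate-pair version
  `gauss_equation_localFrame` by putting an independent pair into a chart basis;
* `apply_eq_apply_of_mfderiv_eq_zero` — a `C¹` function with vanishing differential on a
  connected boundaryless manifold is constant (chart + mean value theorem);
* `cyl_contMDiff_lift_dtField`, `cyl_hasDerivAt_apply_line`, `cyl_hasDerivAt_mvfderiv_dt`,
  `cyl_contMDiff_mvfderiv_dt`, `cyl_gradSq_eq`, `staticCyl_hessian_slice` — calculus on the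
  cylinder: `∂_t` is a smooth field, `∂_t F = dF(∂_t)`, `∂_t² F = Hess F(∂_t, ∂_t)` (the `t`-lines
  are geodesics), `|∇F|²_G = |∇(F ∘ ι_t)|²_{g_t} + (∂_t F)²`, `Hess_{g_t}(F ∘ ι_t) = Hess_G F` on
  horizontal vectors (`K ≡ 0`);
* `staticCyl_mvfderiv_dt_potential_eq_zero`, `staticCyl_potential_split`,
  `staticCyl_slice_soliton`, `staticCyl_normalisedShrinker_slice` — **Step 5 of the printed
  chain**: if `Ric_G + Hess_G F = G/2` on a connected static cylinder then `∂_t F` is constant on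
  the slices and grows at rate `½` along the lines, so `F(z, t) = F(z, t₀) + (t - t₀)²/4`, every
  slice `(N, g_t, F ∘ ι_t)` satisfies `Ric + Hess = g_t/2`, and if moreover `R_G + |∇F|²_G = F`
  then `(N, g_{t₀}, φ = F ∘ ι_{t₀})` is normalised, `R + |∇φ|² = φ` (Haslhofer–Müller 2011, §2,
  p. 5: "the potential has the form `f(x,y) = f̃(x) + ¼|y - y₀|²`"; Naber 2010, proof of
  Lemma 2.1; Bertellotti–Buzano 2025, p. 26).

What remains for `shrinkerSplittingAtInfinity_four_holds` (not in the tree): Munteanu–Wang 2015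
Thm. 1 (`|Rm| ≤ cR` on 4-d shrinkers with bounded `R`), the soliton's canonical Ricci flow and the
essential blow-up sequence, Enders–Müller–Topping 2011 Thm. 1.4 (pointed Cheeger–Gromov–Hamilton
compactness, reduced volume at the singular time, pseudolocality), Naber 2010 Lemma 4.1 (the
isometric splitting of the limit, producing the static cylinder to which this file applies), and
the non-flatness transfer `Rm_G ≢ 0 ⇒ R_h ≢ 0`; plus the named fact `shrinkerPotentialGrowth`
(properness of `f` and of `φ`).

Everything is proved; there are no definitions and no named facts (D-0026).

## References

* B. O'Neill, *Semi-Riemannian geometry with applications to relativity*, Academic Press 1983,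
  Ch. 3, Prop. 3.56–Cor. 3.58 (p. 89); Ch. 4, Def. 4.12–Prop. 4.13 (p. 104); Ch. 7, Cor. 7.36,
  Prop. 7.42, Cor. 7.43 (pp. 206–211). [ONeill1983]
* C. Bär, P. Gauduchon, A. Moroianu, *Generalized cylinders in semi-Riemannian and spin
  geometry*, Math. Z. 249 (2005) 545–580, Prop. 4.1. [folklore]
* A. Naber, *Noncompact shrinking four solitons with nonnegative curvature*, J. reine angew.
  Math. 645 (2010) = arXiv:0710.5579, Lemma 2.1 and its proof, Lemma 4.1. [Naber2010]
* R. Haslhofer, R. Müller, *A compactness theorem for complete Ricci shrinkers*, GAFA 21 (2011)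
  = arXiv:1005.3255, §2, p. 5 (splitting of the potential). [HaslhoferMuller2011]
* A. Bertellotti, R. Buzano, *Geometric structure of ends of Ricci shrinkers*, arXiv:2508.10790,
  §6.2, p. 26. [BertellottiBuzano2025]
-/

noncomputable section

open Bundle Set Filter Function
open scoped Manifold ContDiff Topology

namespace Literature.Geometry.Riemannian

open Literature.Geometry.Lorentzian
open Literature.Geometry.Lorentzian.PseudoRiemannianMetric

variable {E' : Type*} [NormedAddCommGroup E'] [NormedSpace ℝ E'] [FiniteDimensional ℝ E']
  {H' : Type*} [TopologicalSpace H'] {I' : ModelWithCorners ℝ E' H'} [I'.Boundaryless]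
  {N : Type*} [TopologicalSpace N] [ChartedSpace H' N] [IsManifold I' ∞ N]
  (G : PseudoRiemannianMetric (I'.prod 𝓘(ℝ, ℝ)) ∞ (E' × ℝ)
    (TangentSpace (I'.prod 𝓘(ℝ, ℝ)) : N × ℝ → Type _)) [G.HasLeviCivita]

/-! ### The slices of a static cylinder are totally geodesic -/

/-- **The slices of a static generalized cylinder are totally geodesic**: if the slice metrics
`g_t(v, w) = G_{(z,t)}((v,0),(w,0))` of a generalized cylinder do not depend on `t`, then the
second fundamental form `K_t` of every slice `ι_t : z ↦ (z, t)` with respect to `∂_t` vanishes: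
`ġ_t(v, w) = K_t(v, w) + K_t(w, v)` (`hasDerivAt_cyl_val`) is the derivative of a constant
function, and `K_t` is symmetric (`cyl_secondFundamentalForm_symm`). O'Neill 1983, Ch. 7,
Cor. 7.36 (the leaves of a warped product are totally geodesic) with Ch. 4, Def. 4.12.
[cite: ONeill1983, Ch. 7, Cor. 7.36] -/
theorem staticCyl_secondFundamentalForm_eq_zero
    (hcyl : ∀ (p : N × ℝ) (v w : TangentSpace (I'.prod 𝓘(ℝ, ℝ)) p),
      G.val p v w = G.val p ((v.1, 0) : TangentSpace (I'.prod 𝓘(ℝ, ℝ)) p)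
        ((w.1, 0) : TangentSpace (I'.prod 𝓘(ℝ, ℝ)) p) + v.2 * w.2)
    (hstat : ∀ (z : N) (t t' : ℝ) (v w : E'),
      G.val (z, t) ((v, 0) : TangentSpace (I'.prod 𝓘(ℝ, ℝ)) (z, t))
          ((w, 0) : TangentSpace (I'.prod 𝓘(ℝ, ℝ)) (z, t)) =
        G.val (z, t') ((v, 0) : TangentSpace (I'.prod 𝓘(ℝ, ℝ)) (z, t'))
          ((w, 0) : TangentSpace (I'.prod 𝓘(ℝ, ℝ)) (z, t')))
    (z : N) (t : ℝ) (v w : E') :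
    G.secondFundamentalForm I' (fun y : N ↦ ((y, t) : N × ℝ))
      (fun y ↦ velocity (I'.prod 𝓘(ℝ, ℝ)) (fun s : ℝ ↦ ((y, s) : N × ℝ)) t) z v w = 0 := by
  have hd := hasDerivAt_cyl_val G z t v w
  have hconst : (fun τ ↦ G.val (z, τ) ((v, 0) : TangentSpace (I'.prod 𝓘(ℝ, ℝ)) (z, τ))
      ((w, 0) : TangentSpace (I'.prod 𝓘(ℝ, ℝ)) (z, τ))) = fun _ ↦
      G.val ((z, (0 : ℝ)) : N × ℝ) ((v, 0) : TangentSpace (I'.prod 𝓘(ℝ, ℝ)) ((z, (0 : ℝ)) : N × ℝ))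
        ((w, 0) : TangentSpace (I'.prod 𝓘(ℝ, ℝ)) ((z, (0 : ℝ)) : N × ℝ)) :=
    funext fun τ ↦ hstat z τ 0 v w
  rw [hconst] at hd
  have h0 := hd.unique (hasDerivAt_const t _)
  have hs := cyl_secondFundamentalForm_symm G hcyl z t v w
  linarith

/-- The second fundamental forms of the slices of a static generalized cylinder vanish as
bilinear forms (`staticCyl_secondFundamentalForm_eq_zero`). O'Neill 1983, Ch. 7, Cor. 7.36.
[cite: ONeill1983, Ch. 7, Cor. 7.36] -/
theorem staticCyl_secondFundamentalForm_eq_zero'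
    (hcyl : ∀ (p : N × ℝ) (v w : TangentSpace (I'.prod 𝓘(ℝ, ℝ)) p),
      G.val p v w = G.val p ((v.1, 0) : TangentSpace (I'.prod 𝓘(ℝ, ℝ)) p)
        ((w.1, 0) : TangentSpace (I'.prod 𝓘(ℝ, ℝ)) p) + v.2 * w.2)
    (hstat : ∀ (z : N) (t t' : ℝ) (v w : E'),
      G.val (z, t) ((v, 0) : TangentSpace (I'.prod 𝓘(ℝ, ℝ)) (z, t))
          ((w, 0) : TangentSpace (I'.prod 𝓘(ℝ, ℝ)) (z, t)) =
        G.val (z, t') ((v, 0) : TangentSpace (I'.prod 𝓘(ℝ, ℝ)) (z, t'))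
          ((w, 0) : TangentSpace (I'.prod 𝓘(ℝ, ℝ)) (z, t')))
    (z : N) (t : ℝ) :
    G.secondFundamentalForm I' (fun y : N ↦ ((y, t) : N × ℝ))
      (fun y ↦ velocity (I'.prod 𝓘(ℝ, ℝ)) (fun s : ℝ ↦ ((y, s) : N × ℝ)) t) z = 0 := by
  refine LinearMap.ext fun v ↦ LinearMap.ext fun w ↦ ?_
  rw [LinearMap.zero_apply, LinearMap.zero_apply]
  exact staticCyl_secondFundamentalForm_eq_zero G hcyl hstat z t v w

/-- The slices of a static Riemannian generalized cylinder are maximal (minimal): `H_t = 0`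
(`K_t = 0`, `staticCyl_secondFundamentalForm_eq_zero'`). O'Neill 1983, Ch. 7, Cor. 7.36 with
Ch. 4, Def. 4.12. [cite: ONeill1983, Ch. 7, Cor. 7.36] -/
theorem staticCyl_meanCurvature_eq_zero (hG : G.IsRiemannian)
    (hcyl : ∀ (p : N × ℝ) (v w : TangentSpace (I'.prod 𝓘(ℝ, ℝ)) p),
      G.val p v w = G.val p ((v.1, 0) : TangentSpace (I'.prod 𝓘(ℝ, ℝ)) p)
        ((w.1, 0) : TangentSpace (I'.prod 𝓘(ℝ, ℝ)) p) + v.2 * w.2)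
    (hstat : ∀ (z : N) (t t' : ℝ) (v w : E'),
      G.val (z, t) ((v, 0) : TangentSpace (I'.prod 𝓘(ℝ, ℝ)) (z, t))
          ((w, 0) : TangentSpace (I'.prod 𝓘(ℝ, ℝ)) (z, t)) =
        G.val (z, t') ((v, 0) : TangentSpace (I'.prod 𝓘(ℝ, ℝ)) (z, t'))
          ((w, 0) : TangentSpace (I'.prod 𝓘(ℝ, ℝ)) (z, t')))
    (z : N) (t : ℝ) :
    G.meanCurvature (fun y : N ↦ ((y, t) : N × ℝ))
      (contMDiff_pullbackBilin_holds (I := I'.prod 𝓘(ℝ, ℝ)) (M := N × ℝ) (I' := I') (N := N))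
      (isSpacelikeImmersion_cylSlice G hG t)
      (fun y ↦ velocity (I'.prod 𝓘(ℝ, ℝ)) (fun s : ℝ ↦ ((y, s) : N × ℝ)) t) z = 0 := by
  unfold PseudoRiemannianMetric.meanCurvature
  rw [staticCyl_secondFundamentalForm_eq_zero' G hcyl hstat z t]
  simp [PseudoRiemannianMetric.trace]

/-- On a static Riemannian generalized cylinder `|K_t|²_{g_t} = 0` (`K_t = 0`,
`staticCyl_secondFundamentalForm_eq_zero'`). O'Neill 1983, Ch. 7, Cor. 7.36.
[cite: ONeill1983, Ch. 7, Cor. 7.36] -/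
theorem staticCyl_normSq_secondFundamentalForm_eq_zero (hG : G.IsRiemannian)
    (hcyl : ∀ (p : N × ℝ) (v w : TangentSpace (I'.prod 𝓘(ℝ, ℝ)) p),
      G.val p v w = G.val p ((v.1, 0) : TangentSpace (I'.prod 𝓘(ℝ, ℝ)) p)
        ((w.1, 0) : TangentSpace (I'.prod 𝓘(ℝ, ℝ)) p) + v.2 * w.2)
    (hstat : ∀ (z : N) (t t' : ℝ) (v w : E'),
      G.val (z, t) ((v, 0) : TangentSpace (I'.prod 𝓘(ℝ, ℝ)) (z, t))
          ((w, 0) : TangentSpace (I'.prod 𝓘(ℝ, ℝ)) (z, t)) =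
        G.val (z, t') ((v, 0) : TangentSpace (I'.prod 𝓘(ℝ, ℝ)) (z, t'))
          ((w, 0) : TangentSpace (I'.prod 𝓘(ℝ, ℝ)) (z, t')))
    (z : N) (t : ℝ) :
    (G.inducedMetric (fun y : N ↦ ((y, t) : N × ℝ))
        (contMDiff_pullbackBilin_holds (I := I'.prod 𝓘(ℝ, ℝ)) (M := N × ℝ) (I' := I') (N := N))
        (isSpacelikeImmersion_cylSlice G hG t)).normSq z
      (G.secondFundamentalForm I' (fun y : N ↦ ((y, t) : N × ℝ))
        (fun y ↦ velocity (I'.prod 𝓘(ℝ, ℝ)) (fun s : ℝ ↦ ((y, s) : N × ℝ)) t) z) = 0 := by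
  rw [staticCyl_secondFundamentalForm_eq_zero' G hcyl hstat z t]
  simp [PseudoRiemannianMetric.normSq]

/-! ### The induced metric of the slices and the scalar curvature -/

omit [I'.Boundaryless] [G.HasLeviCivita] in
/-- **All slices of a static generalized cylinder carry the same induced metric**
`h = ι_t^* G` (`dι_t v = (v, 0)` and the slice metrics do not depend on `t`). O'Neill 1983,
Ch. 7, Prop. 7.35 ff. (for `f ≡ 1` the projection is an isometry on each leaf).
[cite: ONeill1983, Ch. 3, Cor. 3.58] -/
theorem staticCyl_inducedMetric_eq (hG : G.IsRiemannian)
    (hstat : ∀ (z : N) (t t' : ℝ) (v w : E'),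
      G.val (z, t) ((v, 0) : TangentSpace (I'.prod 𝓘(ℝ, ℝ)) (z, t))
          ((w, 0) : TangentSpace (I'.prod 𝓘(ℝ, ℝ)) (z, t)) =
        G.val (z, t') ((v, 0) : TangentSpace (I'.prod 𝓘(ℝ, ℝ)) (z, t'))
          ((w, 0) : TangentSpace (I'.prod 𝓘(ℝ, ℝ)) (z, t')))
    (t t' : ℝ) :
    G.inducedMetric (fun y : N ↦ ((y, t) : N × ℝ))
        (contMDiff_pullbackBilin_holds (I := I'.prod 𝓘(ℝ, ℝ)) (M := N × ℝ) (I' := I') (N := N))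
        (isSpacelikeImmersion_cylSlice G hG t) =
      G.inducedMetric (fun y : N ↦ ((y, t') : N × ℝ))
        (contMDiff_pullbackBilin_holds (I := I'.prod 𝓘(ℝ, ℝ)) (M := N × ℝ) (I' := I') (N := N))
        (isSpacelikeImmersion_cylSlice G hG t') := by
  refine PseudoRiemannianMetric.ext ?_
  funext y
  refine ContinuousLinearMap.ext fun v ↦ ContinuousLinearMap.ext fun w ↦ ?_
  simp only [inducedMetric_val, inducedBilin_apply, mfderiv_cylSlice_apply]
  exact hstat y t t' v w

omit [FiniteDimensional ℝ E'] [I'.Boundaryless] [IsManifold I' ∞ N] [G.HasLeviCivita] in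
/-- Transport of the scalar curvature along an equality of metrics (the Levi-Civita witnesses are
propositions, so any two agree). [folklore] -/
theorem scalarCurvature_congr_metric {E : Type*} [NormedAddCommGroup E] [NormedSpace ℝ E]
    {H : Type*} [TopologicalSpace H] {I : ModelWithCorners ℝ E H} {M : Type*}
    [TopologicalSpace M] [ChartedSpace H M] [IsManifold I ∞ M] [FiniteDimensional ℝ E]
    [CompleteSpace E] {n : ℕ∞ω} [Fact (1 ≤ n)]
    {g g' : PseudoRiemannianMetric I n E (TangentSpace I : M → Type _)}
    [hg : g.HasLeviCivita] [hg' : g'.HasLeviCivita] (h : g = g') (x : M) :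
    g.scalarCurvature x = g'.scalarCurvature x := by
  subst h
  rfl

/-- **The scalar curvature of a static Riemannian generalized cylinder is that of the slice
through the point**: `R_G(z, t) = R_{g_t}(z)` with `g_t = ι_t^* G` — the generalized-cylinder
formula `R_G = R_{g_t} - |K_t|² - H_t² - 2 ∂_t H_t` (`cyl_scalarCurvature_eq`,
Bär–Gauduchon–Moroianu 2005, Prop. 4.1) with `K ≡ 0`, `H ≡ 0`. O'Neill 1983, Ch. 3, Cor. 3.58
(curvature of a semi-Riemannian product) and Ch. 7, Cor. 7.43 with `f ≡ 1`, traced.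
[cite: ONeill1983, Ch. 7, Cor. 7.43] -/
theorem staticCyl_scalarCurvature_eq_slice (hG : G.IsRiemannian)
    (hcyl : ∀ (p : N × ℝ) (v w : TangentSpace (I'.prod 𝓘(ℝ, ℝ)) p),
      G.val p v w = G.val p ((v.1, 0) : TangentSpace (I'.prod 𝓘(ℝ, ℝ)) p)
        ((w.1, 0) : TangentSpace (I'.prod 𝓘(ℝ, ℝ)) p) + v.2 * w.2)
    (hstat : ∀ (z : N) (t t' : ℝ) (v w : E'),
      G.val (z, t) ((v, 0) : TangentSpace (I'.prod 𝓘(ℝ, ℝ)) (z, t))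
          ((w, 0) : TangentSpace (I'.prod 𝓘(ℝ, ℝ)) (z, t)) =
        G.val (z, t') ((v, 0) : TangentSpace (I'.prod 𝓘(ℝ, ℝ)) (z, t'))
          ((w, 0) : TangentSpace (I'.prod 𝓘(ℝ, ℝ)) (z, t')))
    (z : N) (t : ℝ) :
    haveI := (G.inducedMetric (fun y : N ↦ ((y, t) : N × ℝ))
      (contMDiff_pullbackBilin_holds (I := I'.prod 𝓘(ℝ, ℝ)) (M := N × ℝ) (I' := I') (N := N))
      (isSpacelikeImmersion_cylSlice G hG t)).hasLeviCivita
    G.scalarCurvature (z, t) =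
      (G.inducedMetric (fun y : N ↦ ((y, t) : N × ℝ))
        (contMDiff_pullbackBilin_holds (I := I'.prod 𝓘(ℝ, ℝ)) (M := N × ℝ) (I' := I') (N := N))
        (isSpacelikeImmersion_cylSlice G hG t)).scalarCurvature z := by
  haveI := (G.inducedMetric (fun y : N ↦ ((y, t) : N × ℝ))
    (contMDiff_pullbackBilin_holds (I := I'.prod 𝓘(ℝ, ℝ)) (M := N × ℝ) (I' := I') (N := N))
    (isSpacelikeImmersion_cylSlice G hG t)).hasLeviCivita
  have h := cyl_scalarCurvature_eq G hG hcyl z t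
  have hH : (fun τ ↦ G.meanCurvature (fun y : N ↦ ((y, τ) : N × ℝ))
      (contMDiff_pullbackBilin_holds (I := I'.prod 𝓘(ℝ, ℝ)) (M := N × ℝ) (I' := I') (N := N))
      (isSpacelikeImmersion_cylSlice G hG τ)
      (fun y ↦ velocity (I'.prod 𝓘(ℝ, ℝ)) (fun s : ℝ ↦ ((y, s) : N × ℝ)) τ) z) =
      fun _ ↦ (0 : ℝ) :=
    funext fun τ ↦ staticCyl_meanCurvature_eq_zero G hG hcyl hstat z τ
  rw [h, hH, deriv_const, staticCyl_meanCurvature_eq_zero G hG hcyl hstat z t,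
    staticCyl_normSq_secondFundamentalForm_eq_zero G hG hcyl hstat z t]
  ring

/-- **`R_{h + dt²}(z, t) = R_h(z)`**: the scalar curvature of a static Riemannian generalized
cylinder at `(z, t)` is the scalar curvature at `z` of the common induced metric `h = ι_{t'}^* G`
of the slices, for any reference slice `t'` (`staticCyl_scalarCurvature_eq_slice`,
`staticCyl_inducedMetric_eq`). This is the identity behind the comparison function `R_h ∘ pr₁`
in conclusion (N2) of `shrinkerSplittingAtInfinity_four`. O'Neill 1983, Ch. 3, Cor. 3.58;
Ch. 7, Cor. 7.43 (`f ≡ 1`). [cite: ONeill1983, Ch. 7, Cor. 7.43] -/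
theorem staticCyl_scalarCurvature_eq (hG : G.IsRiemannian)
    (hcyl : ∀ (p : N × ℝ) (v w : TangentSpace (I'.prod 𝓘(ℝ, ℝ)) p),
      G.val p v w = G.val p ((v.1, 0) : TangentSpace (I'.prod 𝓘(ℝ, ℝ)) p)
        ((w.1, 0) : TangentSpace (I'.prod 𝓘(ℝ, ℝ)) p) + v.2 * w.2)
    (hstat : ∀ (z : N) (t t' : ℝ) (v w : E'),
      G.val (z, t) ((v, 0) : TangentSpace (I'.prod 𝓘(ℝ, ℝ)) (z, t))
          ((w, 0) : TangentSpace (I'.prod 𝓘(ℝ, ℝ)) (z, t)) =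
        G.val (z, t') ((v, 0) : TangentSpace (I'.prod 𝓘(ℝ, ℝ)) (z, t'))
          ((w, 0) : TangentSpace (I'.prod 𝓘(ℝ, ℝ)) (z, t')))
    (z : N) (t t' : ℝ) :
    haveI := (G.inducedMetric (fun y : N ↦ ((y, t') : N × ℝ))
      (contMDiff_pullbackBilin_holds (I := I'.prod 𝓘(ℝ, ℝ)) (M := N × ℝ) (I' := I') (N := N))
      (isSpacelikeImmersion_cylSlice G hG t')).hasLeviCivita
    G.scalarCurvature (z, t) =
      (G.inducedMetric (fun y : N ↦ ((y, t') : N × ℝ))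
        (contMDiff_pullbackBilin_holds (I := I'.prod 𝓘(ℝ, ℝ)) (M := N × ℝ) (I' := I') (N := N))
        (isSpacelikeImmersion_cylSlice G hG t')).scalarCurvature z := by
  haveI := (G.inducedMetric (fun y : N ↦ ((y, t') : N × ℝ))
    (contMDiff_pullbackBilin_holds (I := I'.prod 𝓘(ℝ, ℝ)) (M := N × ℝ) (I' := I') (N := N))
    (isSpacelikeImmersion_cylSlice G hG t')).hasLeviCivita
  haveI := (G.inducedMetric (fun y : N ↦ ((y, t) : N × ℝ))
    (contMDiff_pullbackBilin_holds (I := I'.prod 𝓘(ℝ, ℝ)) (M := N × ℝ) (I' := I') (N := N))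
    (isSpacelikeImmersion_cylSlice G hG t)).hasLeviCivita
  rw [staticCyl_scalarCurvature_eq_slice G hG hcyl hstat z t]
  exact scalarCurvature_congr_metric (staticCyl_inducedMetric_eq G hG hstat t t') z

/-! ### The `t`-direction is parallel: `D_v ∂_t = 0`, `Ric(∂_t, ∂_t) = 0`, `R(∂_t, X)∂_t = 0` -/

/-- **On a static Riemannian generalized cylinder `∂_t` is parallel along the slices**:
`D_v ∂_t = 0` for `v ∈ T_zN` — `|D_v ∂_t|² = ∑ₗ K(v, βₗ)²/aₗ` in a `g_t`-orthogonal frame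
(`val_normalDerivAlong_self_eq_sum`) with `K ≡ 0`, and `G` is positive definite. O'Neill 1983,
Ch. 3, Prop. 3.56 (3) (`D_V X = 0` on a semi-Riemannian product); Ch. 7, Prop. 7.35.
[cite: ONeill1983, Ch. 3, Prop. 3.56] -/
theorem staticCyl_normalDerivAlong_eq_zero (hG : G.IsRiemannian)
    (hcyl : ∀ (p : N × ℝ) (v w : TangentSpace (I'.prod 𝓘(ℝ, ℝ)) p),
      G.val p v w = G.val p ((v.1, 0) : TangentSpace (I'.prod 𝓘(ℝ, ℝ)) p)
        ((w.1, 0) : TangentSpace (I'.prod 𝓘(ℝ, ℝ)) p) + v.2 * w.2)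
    (hstat : ∀ (z : N) (t t' : ℝ) (v w : E'),
      G.val (z, t) ((v, 0) : TangentSpace (I'.prod 𝓘(ℝ, ℝ)) (z, t))
          ((w, 0) : TangentSpace (I'.prod 𝓘(ℝ, ℝ)) (z, t)) =
        G.val (z, t') ((v, 0) : TangentSpace (I'.prod 𝓘(ℝ, ℝ)) (z, t'))
          ((w, 0) : TangentSpace (I'.prod 𝓘(ℝ, ℝ)) (z, t')))
    (z : N) (t : ℝ) (v : E') :
    G.normalDerivAlong (I' := I') (fun y : N ↦ ((y, t) : N × ℝ))
      (fun y ↦ velocity (I'.prod 𝓘(ℝ, ℝ)) (fun s : ℝ ↦ ((y, s) : N × ℝ)) t) z v = 0 := by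
  classical
  set hpb := contMDiff_pullbackBilin_holds (I := I'.prod 𝓘(ℝ, ℝ)) (M := N × ℝ) (I' := I') (N := N)
    (n := (∞ : ℕ∞ω)) with hpb_def
  have hfi := isSpacelikeImmersion_cylSlice G hG t
  set gN := G.inducedMetric (fun y : N ↦ ((y, t) : N × ℝ)) hpb hfi with hgN
  obtain ⟨β, hβ, hdβ⟩ := exists_isOrthoᵢ_basis gN z
  set D : TangentSpace (I'.prod 𝓘(ℝ, ℝ)) ((z, t) : N × ℝ) :=
    G.normalDerivAlong (I' := I') (fun y : N ↦ ((y, t) : N × ℝ))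
      (fun y ↦ velocity (I'.prod 𝓘(ℝ, ℝ)) (fun s : ℝ ↦ ((y, s) : N × ℝ)) t) z v with hD
  have hsum := val_normalDerivAlong_self_eq_sum G hpb hfi (contMDiff_lift_velocity_cylSlice t)
    (isUnitNormal_cylSlice G hcyl t) one_ne_zero finrank_cylModel z β hβ hdβ v
  have hzero : G.val (z, t) D D = 0 := by
    rw [hD, hsum]
    refine Finset.sum_eq_zero fun l _ ↦ ?_
    rw [staticCyl_secondFundamentalForm_eq_zero G hcyl hstat z t v (β l)]
    simp
  by_contra hne
  exact (lt_irrefl (0 : ℝ)) ((hG (z, t) D hne).trans_eq hzero)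

/-- **`Ric(∂_t, ∂_t) = 0` on a static Riemannian generalized cylinder**: the Raychaudhuri
equation `∂_t H_t = -(|K_t|² + Ric(∂_t, ∂_t))` (`hasDerivAt_cyl_meanCurvature`) with `H ≡ 0`,
`K ≡ 0`. O'Neill 1983, Ch. 3, Cor. 3.58 (3); Ch. 7, Cor. 7.43 (3) with `f ≡ 1`, `d = 1`
(read through Prop. 7.42 (2): `R_{V X}Y = (H^f(X,Y)/f) V = 0`). [cite: ONeill1983, Ch. 7, Cor. 7.43] -/
theorem staticCyl_ricci_inr_inr (hG : G.IsRiemannian)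
    (hcyl : ∀ (p : N × ℝ) (v w : TangentSpace (I'.prod 𝓘(ℝ, ℝ)) p),
      G.val p v w = G.val p ((v.1, 0) : TangentSpace (I'.prod 𝓘(ℝ, ℝ)) p)
        ((w.1, 0) : TangentSpace (I'.prod 𝓘(ℝ, ℝ)) p) + v.2 * w.2)
    (hstat : ∀ (z : N) (t t' : ℝ) (v w : E'),
      G.val (z, t) ((v, 0) : TangentSpace (I'.prod 𝓘(ℝ, ℝ)) (z, t))
          ((w, 0) : TangentSpace (I'.prod 𝓘(ℝ, ℝ)) (z, t)) =
        G.val (z, t') ((v, 0) : TangentSpace (I'.prod 𝓘(ℝ, ℝ)) (z, t'))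
          ((w, 0) : TangentSpace (I'.prod 𝓘(ℝ, ℝ)) (z, t')))
    (z : N) (t : ℝ) :
    G.ricci (z, t) (((0 : E'), (1 : ℝ)) : TangentSpace (I'.prod 𝓘(ℝ, ℝ)) (z, t))
      (((0 : E'), (1 : ℝ)) : TangentSpace (I'.prod 𝓘(ℝ, ℝ)) (z, t)) = 0 := by
  have hd := hasDerivAt_cyl_meanCurvature G hG hcyl z t
  have hH : (fun τ ↦ G.meanCurvature (fun y : N ↦ ((y, τ) : N × ℝ))
      (contMDiff_pullbackBilin_holds (I := I'.prod 𝓘(ℝ, ℝ)) (M := N × ℝ) (I' := I') (N := N))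
      (isSpacelikeImmersion_cylSlice G hG τ)
      (fun y ↦ velocity (I'.prod 𝓘(ℝ, ℝ)) (fun s : ℝ ↦ ((y, s) : N × ℝ)) τ) z) =
      fun _ ↦ (0 : ℝ) :=
    funext fun τ ↦ staticCyl_meanCurvature_eq_zero G hG hcyl hstat z τ
  rw [hH, staticCyl_normSq_secondFundamentalForm_eq_zero G hG hcyl hstat z t] at hd
  have h0 := hd.unique (hasDerivAt_const t (0 : ℝ))
  linarith

/-- **`G(R(∂_t, (w,0))∂_t, (w,0)) = 0` on a static Riemannian generalized cylinder**: the
Riccati identity `(d/dt) K_t(w, w) = G(R(∂_t, (w,0)) ∂_t, (w,0)) + |D_w ∂_t|²`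
(`hasDerivAt_cyl_secondFundamentalForm_self`) with `K ≡ 0` and `D_w ∂_t = 0`
(`staticCyl_normalDerivAlong_eq_zero`). O'Neill 1983, Ch. 3, Cor. 3.58 (3) (`R` vanishes on
mixed arguments of a semi-Riemannian product); Ch. 7, Prop. 7.42 (2) with `f ≡ 1`.
[cite: ONeill1983, Ch. 7, Prop. 7.42] -/
theorem staticCyl_val_riemann_inr_inl_inr_self (hG : G.IsRiemannian)
    (hcyl : ∀ (p : N × ℝ) (v w : TangentSpace (I'.prod 𝓘(ℝ, ℝ)) p),
      G.val p v w = G.val p ((v.1, 0) : TangentSpace (I'.prod 𝓘(ℝ, ℝ)) p)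
        ((w.1, 0) : TangentSpace (I'.prod 𝓘(ℝ, ℝ)) p) + v.2 * w.2)
    (hstat : ∀ (z : N) (t t' : ℝ) (v w : E'),
      G.val (z, t) ((v, 0) : TangentSpace (I'.prod 𝓘(ℝ, ℝ)) (z, t))
          ((w, 0) : TangentSpace (I'.prod 𝓘(ℝ, ℝ)) (z, t)) =
        G.val (z, t') ((v, 0) : TangentSpace (I'.prod 𝓘(ℝ, ℝ)) (z, t'))
          ((w, 0) : TangentSpace (I'.prod 𝓘(ℝ, ℝ)) (z, t')))
    (z : N) (t : ℝ) (w : E') :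
    G.val (z, t)
      (G.riemann (z, t) (((0 : E'), (1 : ℝ)) : TangentSpace (I'.prod 𝓘(ℝ, ℝ)) (z, t))
        ((w, 0) : TangentSpace (I'.prod 𝓘(ℝ, ℝ)) (z, t))
        (((0 : E'), (1 : ℝ)) : TangentSpace (I'.prod 𝓘(ℝ, ℝ)) (z, t)))
      ((w, 0) : TangentSpace (I'.prod 𝓘(ℝ, ℝ)) (z, t)) = 0 := by
  have hd := hasDerivAt_cyl_secondFundamentalForm_self G hcyl z t w
  have hK : (fun τ ↦ G.secondFundamentalForm I' (fun y : N ↦ ((y, τ) : N × ℝ))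
      (fun y ↦ velocity (I'.prod 𝓘(ℝ, ℝ)) (fun s : ℝ ↦ ((y, s) : N × ℝ)) τ) z w w) =
      fun _ ↦ (0 : ℝ) :=
    funext fun τ ↦ staticCyl_secondFundamentalForm_eq_zero G hcyl hstat z τ w w
  rw [hK, staticCyl_normalDerivAlong_eq_zero G hG hcyl hstat z t w, map_zero, add_zero] at hd
  exact ((hasDerivAt_const t (0 : ℝ)).unique hd).symm

/-! ### `Ric(∂_t, (v, 0)) = 0`: the reflection `t ↦ 2t₀ - t` is an isometry -/

omit [FiniteDimensional ℝ E'] [I'.Boundaryless] [IsManifold I' ∞ N] [G.HasLeviCivita] in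
/-- Transport of the Ricci tensor along an equality of metrics (the Levi-Civita witnesses are
propositions, so any two agree). [folklore] -/
theorem ricci_congr_metric {E : Type*} [NormedAddCommGroup E] [NormedSpace ℝ E]
    {H : Type*} [TopologicalSpace H] {I : ModelWithCorners ℝ E H} {M : Type*}
    [TopologicalSpace M] [ChartedSpace H M] [IsManifold I ∞ M] [FiniteDimensional ℝ E]
    [CompleteSpace E] {n : ℕ∞ω} [Fact (1 ≤ n)]
    {g g' : PseudoRiemannianMetric I n E (TangentSpace I : M → Type _)}
    [hg : g.HasLeviCivita] [hg' : g'.HasLeviCivita] (h : g = g') (x : M)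
    (X₀ Y₀ : TangentSpace I x) :
    g.ricci x X₀ Y₀ = g'.ricci x X₀ Y₀ := by
  subst h
  rfl

omit [I'.Boundaryless] in
/-- **`Ric(∂_t, (v, 0)) = 0` on a static generalized cylinder.** The reflection
`Φ(z, t) = (z, 2t₀ - t)` is an isometry of `G` (cylinder property and staticity) fixing the
slice `t = t₀`, with `dΦ(v, 0) = (v, 0)` and `dΦ ∂_t = -∂_t` there; by naturality of the Ricci
tensor (`ricci_comap_apply`, O'Neill 1983, Ch. 3, Prop. 3.59),
`Ric_{(z,t₀)}(∂_t, (v,0)) = Ric_{(z,t₀)}(-∂_t, (v,0))`, whence zero. This is O'Neill 1983,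
Ch. 3, Cor. 3.58 (3) / Ch. 7, Cor. 7.43 (2) (`Ric(X, V) = 0` on a warped product) for `f ≡ 1`.
[cite: ONeill1983, Ch. 7, Cor. 7.43] -/
theorem staticCyl_ricci_inr_inl
    (hcyl : ∀ (p : N × ℝ) (v w : TangentSpace (I'.prod 𝓘(ℝ, ℝ)) p),
      G.val p v w = G.val p ((v.1, 0) : TangentSpace (I'.prod 𝓘(ℝ, ℝ)) p)
        ((w.1, 0) : TangentSpace (I'.prod 𝓘(ℝ, ℝ)) p) + v.2 * w.2)
    (hstat : ∀ (z : N) (t t' : ℝ) (v w : E'),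
      G.val (z, t) ((v, 0) : TangentSpace (I'.prod 𝓘(ℝ, ℝ)) (z, t))
          ((w, 0) : TangentSpace (I'.prod 𝓘(ℝ, ℝ)) (z, t)) =
        G.val (z, t') ((v, 0) : TangentSpace (I'.prod 𝓘(ℝ, ℝ)) (z, t'))
          ((w, 0) : TangentSpace (I'.prod 𝓘(ℝ, ℝ)) (z, t')))
    (z : N) (t₀ : ℝ) (v : E') :
    G.ricci (z, t₀) (((0 : E'), (1 : ℝ)) : TangentSpace (I'.prod 𝓘(ℝ, ℝ)) (z, t₀))
      ((v, 0) : TangentSpace (I'.prod 𝓘(ℝ, ℝ)) (z, t₀)) = 0 := by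
  haveI : CompleteSpace E' := FiniteDimensional.complete ℝ E'
  set I2 := I'.prod 𝓘(ℝ, ℝ) with hI2
  -- the reflection and its differential
  set ρ : ℝ → ℝ := fun t ↦ 2 * t₀ - t with hρ
  set Φ : N × ℝ → N × ℝ := Prod.map id ρ with hΦ
  have hρc : ContDiff ℝ ω (fun t : ℝ ↦ 2 * t₀ - t) := contDiff_const.sub contDiff_id
  have hρω : ContMDiff 𝓘(ℝ, ℝ) 𝓘(ℝ, ℝ) ω ρ := hρc.contMDiff
  have hρs : ContMDiff 𝓘(ℝ, ℝ) 𝓘(ℝ, ℝ) (∞ + 1) ρ := hρω.of_le le_top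
  have hρd : MDifferentiable 𝓘(ℝ, ℝ) 𝓘(ℝ, ℝ) ρ :=
    (hρω.of_le (show (1 : ℕ∞ω) ≤ ω from le_top)).mdifferentiable one_ne_zero
  have hΦs : ContMDiff I2 I2 (∞ + 1) Φ := contMDiff_id.prodMap hρs
  have hdρ : ∀ t : ℝ, mfderiv 𝓘(ℝ, ℝ) 𝓘(ℝ, ℝ) ρ t = -ContinuousLinearMap.id ℝ ℝ := by
    intro t
    rw [mfderiv_eq_fderiv]
    have h : HasFDerivAt ρ (-ContinuousLinearMap.id ℝ ℝ) t := by
      have h1 : HasFDerivAt (fun t : ℝ ↦ 2 * t₀ - t)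
          ((0 : ℝ →L[ℝ] ℝ) - ContinuousLinearMap.id ℝ ℝ) t :=
        (hasFDerivAt_const (2 * t₀) t).sub (hasFDerivAt_id t)
      simpa using h1
    exact h.fderiv
  have hdΦ : ∀ (p : N × ℝ) (w : TangentSpace I2 p),
      mfderiv I2 I2 Φ p w = ((w.1, -w.2) : TangentSpace I2 (Φ p)) := by
    intro p w
    have h := mfderiv_prodMap (I := I') (I' := 𝓘(ℝ, ℝ)) (J := I') (J' := 𝓘(ℝ, ℝ)) (p := p)
      (f := (id : N → N)) (g := ρ) mdifferentiableAt_id (hρd p.2)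
    rw [hΦ, h, mfderiv_id, hdρ]
    rfl
  have hΦinj : ∀ p, Function.Injective (mfderiv I2 I2 Φ p) := by
    intro p w w' h
    rw [hdΦ, hdΦ] at h
    have h1 := congrArg Prod.fst h
    have h2 := congrArg Prod.snd h
    simp only [neg_inj] at h1 h2
    exact Prod.ext h1 h2
  -- `Φ` is an isometry of `G`
  set hpb := contMDiff_pullbackBilin_holds (I := I2) (M := N × ℝ) (I' := I2) (N := N × ℝ)
    (n := (∞ : ℕ∞ω)) with hpb_def
  have hiso : G.comap hpb Φ hΦs hΦinj rfl = G := by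
    refine PseudoRiemannianMetric.ext ?_
    funext p
    refine ContinuousLinearMap.ext fun w ↦ ContinuousLinearMap.ext fun w' ↦ ?_
    rw [val_comap, pullbackBilin_apply, hdΦ, hdΦ]
    obtain ⟨y, t⟩ := p
    rw [hcyl (Φ (y, t)), hcyl ((y, t) : N × ℝ)]
    show G.val (y, ρ t) ((w.1, 0) : TangentSpace I2 (y, ρ t)) ((w'.1, 0) : TangentSpace I2 (y, ρ t))
        + -w.2 * -w'.2 = G.val (y, t) ((w.1, 0) : TangentSpace I2 (y, t))
        ((w'.1, 0) : TangentSpace I2 (y, t)) + w.2 * w'.2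
    rw [hstat y (ρ t) t w.1 w'.1, neg_mul_neg]
  -- naturality of the Ricci tensor at the fixed point `(z, t₀)`
  haveI := (G.comap hpb Φ hΦs hΦinj rfl).hasLeviCivita
  have hfix : Φ (z, t₀) = (z, t₀) := by
    show (id z, 2 * t₀ - t₀) = (z, t₀)
    rw [id, two_mul, add_sub_cancel_right]
  have hnat := ricci_comap_apply G hpb hΦs hΦinj rfl ((z, t₀) : N × ℝ)
    (((0 : E'), (1 : ℝ)) : TangentSpace I2 (z, t₀)) ((v, 0) : TangentSpace I2 (z, t₀))
  rw [ricci_congr_metric hiso, hdΦ, hdΦ] at hnat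
  -- rewrite the base point `Φ (z, t₀) = (z, t₀)` and conclude `Ric(∂_t, v) = Ric(-∂_t, v)`
  have key : ∀ q : N × ℝ, q = ((z, t₀) : N × ℝ) →
      G.ricci q (((0 : E'), -(1 : ℝ)) : TangentSpace I2 q) ((v, -0) : TangentSpace I2 q) =
        G.ricci (z, t₀) (((0 : E'), -(1 : ℝ)) : TangentSpace I2 (z, t₀))
          ((v, 0) : TangentSpace I2 (z, t₀)) := by
    rintro q rfl
    rw [neg_zero]
  rw [key _ hfix] at hnat
  have hneg : (((0 : E'), -(1 : ℝ)) : TangentSpace I2 (z, t₀)) =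
      -(((0 : E'), (1 : ℝ)) : TangentSpace I2 (z, t₀)) := Prod.ext (by simp) rfl
  have h3 : G.ricci (z, t₀) (((0 : E'), -(1 : ℝ)) : TangentSpace I2 (z, t₀))
      ((v, 0) : TangentSpace I2 (z, t₀)) =
      -(G.ricci (z, t₀) (((0 : E'), (1 : ℝ)) : TangentSpace I2 (z, t₀))
        ((v, 0) : TangentSpace I2 (z, t₀))) := by
    have h := LinearMap.map_neg₂ (G.ricci (z, t₀)) (((0 : E'), (1 : ℝ)) : TangentSpace I2 (z, t₀))
      ((v, 0) : TangentSpace I2 (z, t₀))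
    exact (congrArg (fun T : TangentSpace I2 (z, t₀) ↦
      G.ricci (z, t₀) T ((v, 0) : TangentSpace I2 (z, t₀))) hneg).trans h
  have h4 := hnat.trans h3
  linarith

/-! ### The Gauss equation on an arbitrary pair of tangent vectors -/

section PairGauss

variable {E : Type*} [NormedAddCommGroup E] [NormedSpace ℝ E] {H : Type*} [TopologicalSpace H]
  {I : ModelWithCorners ℝ E H} {M : Type*} [TopologicalSpace M] [ChartedSpace H M]
  [IsManifold I ∞ M] [FiniteDimensional ℝ E] [CompleteSpace E]
  (g : PseudoRiemannianMetric I ∞ E (TangentSpace I : M → Type _)) [g.HasLeviCivita]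
  {E'' : Type*} [NormedAddCommGroup E''] [NormedSpace ℝ E''] {H'' : Type*} [TopologicalSpace H'']
  {I'' : ModelWithCorners ℝ E'' H''} {P : Type*} [TopologicalSpace P] [ChartedSpace H'' P]
  [IsManifold I'' ∞ P] [FiniteDimensional ℝ E''] [CompleteSpace E''] [I''.Boundaryless]
  {f : P → M} (hpb : contMDiff_pullbackBilin I M I'' P ∞) (hfi : g.IsSpacelikeImmersion I'' f)
  {ν : NormalField I f} {ε : ℝ}

/-- **The Gauss equation on an arbitrary pair of tangent vectors** (O'Neill 1983, Ch. 4, Thm. 4.5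
and Cor. 4.6: "these are tensor equations, hence valid for individual tangent vectors"): for a
smooth spacelike immersed hypersurface `f : (P, f^*g) → (M, g)` with unit normal `ν` of sign
`ε ≠ 0` and ALL `X, Y ∈ T_{y₀}P`,
`(f^*g)(R(X,Y)Y, X) = g(R̄(df X, df Y)df Y, df X) + (K(X,X)K(Y,Y) - K(X,Y)K(Y,X))/ε`.
The tree's `gauss_equation_localFrame` gives this on pairs of coordinate vectors of an arbitrary
chart basis; a linearly independent pair is part of a basis (`Module.Basis.extend`) whose
coordinate frame at `y₀` it is (`localFrame_trivializationAt_self`), and for a dependent pair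
both sides vanish (antisymmetry of `R`, `R̄` in the first pair). [cite: ONeill1983, Ch. 4, Thm. 4.5] -/
theorem gauss_equation_pair
    (hν : ContMDiff I'' I.tangent ∞ (fun x ↦ (TotalSpace.mk' E (f x) (ν x) : TangentBundle I M)))
    (hun : g.IsUnitNormal I'' f ν ε) (hε : ε ≠ 0)
    (hdim : Module.finrank ℝ E = Module.finrank ℝ E'' + 1) (y₀ : P) (X Y : TangentSpace I'' y₀) :
    haveI := (g.inducedMetric f hpb hfi).hasLeviCivita
    (g.inducedMetric f hpb hfi).val y₀ ((g.inducedMetric f hpb hfi).riemann y₀ X Y Y) X =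
      g.val (f y₀) (g.riemann (f y₀) (mfderiv I'' I f y₀ X) (mfderiv I'' I f y₀ Y)
        (mfderiv I'' I f y₀ Y)) (mfderiv I'' I f y₀ X) +
        (g.secondFundamentalForm I'' f ν y₀ X X * g.secondFundamentalForm I'' f ν y₀ Y Y -
          g.secondFundamentalForm I'' f ν y₀ X Y * g.secondFundamentalForm I'' f ν y₀ Y X) / ε := by
  classical
  haveI := (g.inducedMetric f hpb hfi).hasLeviCivita
  by_cases hli : LinearIndependent ℝ ![X, Y]
  · -- a linearly independent pair is part of a chart basis
    have hs : LinearIndepOn ℝ id (Set.range ![X, Y]) := hli.linearIndepOn_id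
    set b := Module.Basis.extend hs with hb
    haveI : FiniteDimensional ℝ (TangentSpace I'' y₀) :=
      inferInstanceAs (FiniteDimensional ℝ E'')
    haveI : Finite (hs.extend (Set.subset_univ (Set.range ![X, Y]))) := Module.Finite.finite_basis b
    haveI : Fintype (hs.extend (Set.subset_univ (Set.range ![X, Y]))) := Fintype.ofFinite _
    have hXm : X ∈ hs.extend (Set.subset_univ (Set.range ![X, Y])) :=
      Module.Basis.subset_extend hs ⟨0, rfl⟩
    have hYm : Y ∈ hs.extend (Set.subset_univ (Set.range ![X, Y])) :=
      Module.Basis.subset_extend hs ⟨1, rfl⟩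
    have hG := gauss_equation_localFrame g hpb hfi b hν hun hε hdim (y₀ := y₀) ⟨X, hXm⟩ ⟨Y, hYm⟩
    have hbX : (trivializationAt E'' (TangentSpace I'') y₀).localFrame b ⟨X, hXm⟩ y₀ = X := by
      rw [localFrame_trivializationAt_self]; exact Module.Basis.extend_apply_self hs _
    have hbY : (trivializationAt E'' (TangentSpace I'') y₀).localFrame b ⟨Y, hYm⟩ y₀ = Y := by
      rw [localFrame_trivializationAt_self]; exact Module.Basis.extend_apply_self hs _
    rw [hbX, hbY] at hG
    exact hG
  · -- a dependent pair: both sides vanish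
    rw [LinearIndependent.pair_iff] at hli
    push Not at hli
    obtain ⟨s, t, hst, hne⟩ := hli
    by_cases ht : t = 0
    · have hs0 : s ≠ 0 := fun h ↦ hne h ht
      rw [ht, zero_smul, add_zero] at hst
      have hX : X = 0 := (smul_eq_zero.mp hst).resolve_left hs0
      subst hX
      have h1 : (g.inducedMetric f hpb hfi).val y₀ ((g.inducedMetric f hpb hfi).riemann y₀ 0 Y Y)
          (0 : TangentSpace I'' y₀) = 0 := map_zero _
      have h2 : mfderiv I'' I f y₀ (0 : TangentSpace I'' y₀) = 0 := map_zero _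
      have h3 : g.secondFundamentalForm I'' f ν y₀ (0 : TangentSpace I'' y₀) = 0 := map_zero _
      have h4 : g.secondFundamentalForm I'' f ν y₀ Y (0 : TangentSpace I'' y₀) = 0 := map_zero _
      have h5 : ∀ R : TangentSpace I (f y₀), g.val (f y₀) R (0 : TangentSpace I (f y₀)) = 0 :=
        fun R ↦ map_zero _
      rw [h1, h2, h5, h3, LinearMap.zero_apply, LinearMap.zero_apply, h4]
      ring
    · have hY : Y = (-(s / t)) • X := by
        have h1 : t • Y = -(s • X) := eq_neg_of_add_eq_zero_right hst
        calc Y = t⁻¹ • (t • Y) := by rw [smul_smul, inv_mul_cancel₀ ht, one_smul]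
          _ = (-(s / t)) • X := by rw [h1, smul_neg, smul_smul, ← neg_smul, div_eq_inv_mul]
      subst hY
      simp only [map_smul, FunLike.coe_smul, Pi.smul_apply, LinearMap.smul_apply,
        smul_eq_mul, val_riemann_self₁₂, mul_zero]
      ring

end PairGauss

/-! ### The horizontal Ricci curvature: `Ric_G((v,0),(w,0)) = Ric_h(v,w)` -/

/-- **The horizontal Ricci curvature of a static Riemannian generalized cylinder is the Ricci
curvature of the slice**, quadratic form: `Ric_G((u,0),(u,0))(z,t) = Ric_{g_t}(u,u)(z)`. In a
`g_t`-orthogonal basis `β` of `T_zN` completed by `∂_t` to a `G`-orthogonal basis of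
`T_{(z,t)}(N × ℝ)` (O'Neill 1983, Ch. 3, Lemma 3.52): the horizontal terms agree by the Gauss
equation with `K ≡ 0` (`gauss_equation_pair`, `staticCyl_secondFundamentalForm_eq_zero`), and
the term through `∂_t`, `G(R(∂_t,u)u, ∂_t) = -G(R(∂_t,u)∂_t, u)`, vanishes
(`staticCyl_val_riemann_inr_inl_inr_self`). O'Neill 1983, Ch. 3, Cor. 3.58 (1); Ch. 7,
Cor. 7.43 (1) with `f ≡ 1`. [cite: ONeill1983, Ch. 7, Cor. 7.43] -/
theorem staticCyl_ricci_inl_inl_self (hG : G.IsRiemannian)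
    (hcyl : ∀ (p : N × ℝ) (v w : TangentSpace (I'.prod 𝓘(ℝ, ℝ)) p),
      G.val p v w = G.val p ((v.1, 0) : TangentSpace (I'.prod 𝓘(ℝ, ℝ)) p)
        ((w.1, 0) : TangentSpace (I'.prod 𝓘(ℝ, ℝ)) p) + v.2 * w.2)
    (hstat : ∀ (z : N) (t t' : ℝ) (v w : E'),
      G.val (z, t) ((v, 0) : TangentSpace (I'.prod 𝓘(ℝ, ℝ)) (z, t))
          ((w, 0) : TangentSpace (I'.prod 𝓘(ℝ, ℝ)) (z, t)) =
        G.val (z, t') ((v, 0) : TangentSpace (I'.prod 𝓘(ℝ, ℝ)) (z, t'))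
          ((w, 0) : TangentSpace (I'.prod 𝓘(ℝ, ℝ)) (z, t')))
    (z : N) (t : ℝ) (u : E') :
    haveI := (G.inducedMetric (fun y : N ↦ ((y, t) : N × ℝ))
      (contMDiff_pullbackBilin_holds (I := I'.prod 𝓘(ℝ, ℝ)) (M := N × ℝ) (I' := I') (N := N))
      (isSpacelikeImmersion_cylSlice G hG t)).hasLeviCivita
    G.ricci (z, t) ((u, 0) : TangentSpace (I'.prod 𝓘(ℝ, ℝ)) (z, t))
        ((u, 0) : TangentSpace (I'.prod 𝓘(ℝ, ℝ)) (z, t)) =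
      (G.inducedMetric (fun y : N ↦ ((y, t) : N × ℝ))
        (contMDiff_pullbackBilin_holds (I := I'.prod 𝓘(ℝ, ℝ)) (M := N × ℝ) (I' := I') (N := N))
        (isSpacelikeImmersion_cylSlice G hG t)).ricci z u u := by
  classical
  haveI : CompleteSpace E' := FiniteDimensional.complete ℝ E'
  set I2 := I'.prod 𝓘(ℝ, ℝ) with hI2
  set hpb := contMDiff_pullbackBilin_holds (I := I2) (M := N × ℝ) (I' := I') (N := N)
    (n := (∞ : ℕ∞ω)) with hpb_def
  have hfi := isSpacelikeImmersion_cylSlice G hG t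
  haveI := (G.inducedMetric (fun y : N ↦ ((y, t) : N × ℝ)) hpb hfi).hasLeviCivita
  set gN := G.inducedMetric (fun y : N ↦ ((y, t) : N × ℝ)) hpb hfi with hgN
  -- a `g_t`-orthogonal basis `β` of `T_zN`, indexed by `Fin m`, `m = dim N`
  set m := Module.finrank ℝ E' with hm_def
  obtain ⟨β₀, hβ₀, hdβ₀⟩ := exists_isOrthoᵢ_basis gN z
  have hfin : Module.finrank ℝ (TangentSpace I' z) = m := rfl
  set β : Module.Basis (Fin m) ℝ (TangentSpace I' z) := β₀.reindex (finCongr hfin) with hβdef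
  have hβapply : ∀ k, β k = β₀ ((finCongr hfin).symm k) := fun k ↦ Module.Basis.reindex_apply _ _ _
  have hβ : (gN.toBilinForm z).IsOrthoᵢ β := by
    intro k l hkl
    simp only [Function.onFun, hβapply]
    exact hβ₀ fun h ↦ hkl ((finCongr hfin).symm.injective h)
  have hdβ : ∀ k, gN.val z (β k) (β k) ≠ 0 := fun k ↦ by rw [hβapply]; exact hdβ₀ _
  have hval : ∀ v w : E', gN.val z v w =
      G.val (z, t) ((v, 0) : TangentSpace I2 (z, t)) ((w, 0) : TangentSpace I2 (z, t)) := by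
    intro v w
    rw [hgN, inducedMetric_val, inducedBilin_apply, mfderiv_cylSlice_apply, mfderiv_cylSlice_apply]
  -- the slice side, by the Ricci formula in the frame `β` and the Gauss equation with `K = 0`
  have hN := ricci_eq_sum_of_isOrthoᵢ gN z β hβ hdβ u u
  have hGauss : ∀ i, gN.val z (gN.riemann z (β i) u u) (β i) =
      G.val (z, t) (G.riemann (z, t) ((β i, 0) : TangentSpace I2 (z, t))
        ((u, 0) : TangentSpace I2 (z, t)) ((u, 0) : TangentSpace I2 (z, t)))
        ((β i, 0) : TangentSpace I2 (z, t)) := by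
    intro i
    have h := gauss_equation_pair G hpb hfi (contMDiff_lift_velocity_cylSlice t)
      (isUnitNormal_cylSlice G hcyl t) one_ne_zero finrank_cylModel z (β i) u
    simp only [staticCyl_secondFundamentalForm_eq_zero G hcyl hstat z t, mfderiv_cylSlice_apply,
      mul_zero, sub_zero, zero_div, add_zero] at h
    exact h
  -- the cylinder side: the `G`-orthogonal basis `((β i, 0))ᵢ, ∂_t` of `T_{(z,t)}(N × ℝ)`
  set e : Fin (m + 1) → TangentSpace I2 (z, t) :=
    Fin.snoc (α := fun _ ↦ TangentSpace I2 (z, t))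
      (fun i ↦ ((β i, 0) : TangentSpace I2 (z, t))) (((0 : E'), (1 : ℝ)) : TangentSpace I2 (z, t))
    with he
  have hec : ∀ i : Fin m, e i.castSucc = ((β i, 0) : TangentSpace I2 (z, t)) := fun i ↦ by
    simp [he]
  have hel : e (Fin.last m) = (((0 : E'), (1 : ℝ)) : TangentSpace I2 (z, t)) := by simp [he]
  have hn0 : ∀ i : Fin m, G.val (z, t) ((β i, 0) : TangentSpace I2 (z, t))
      (((0 : E'), (1 : ℝ)) : TangentSpace I2 (z, t)) = 0 := fun i ↦ cyl_val_inl_inr G hcyl (z, t) (β i)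
  have h11 : G.val (z, t) (((0 : E'), (1 : ℝ)) : TangentSpace I2 (z, t))
      (((0 : E'), (1 : ℝ)) : TangentSpace I2 (z, t)) = 1 := cyl_val_inr_inr G hcyl (z, t)
  have heo : (G.toBilinForm (z, t)).IsOrthoᵢ e := by
    intro k l hkl
    simp only [Function.onFun, PseudoRiemannianMetric.toBilinForm_apply]
    induction k using Fin.lastCases with
    | last =>
      induction l using Fin.lastCases with
      | last => exact absurd rfl hkl
      | cast j => rw [hel, hec, G.symm]; exact hn0 j
    | cast i =>
      induction l using Fin.lastCases with
      | last => rw [hel, hec]; exact hn0 i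
      | cast j =>
        rw [hec, hec, ← hval]
        exact hβ fun h ↦ hkl (by rw [h])
  have hed : ∀ k, G.toBilinForm (z, t) (e k) (e k) ≠ 0 := by
    intro k
    induction k using Fin.lastCases with
    | last => rw [PseudoRiemannianMetric.toBilinForm_apply, hel, h11]; exact one_ne_zero
    | cast i => rw [PseudoRiemannianMetric.toBilinForm_apply, hec, ← hval]; exact hdβ i
  have hli : LinearIndependent ℝ e := LinearMap.linearIndependent_of_isOrthoᵢ heo hed
  haveI : FiniteDimensional ℝ (TangentSpace I2 ((z, t) : N × ℝ)) :=
    inferInstanceAs (FiniteDimensional ℝ (E' × ℝ))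
  have hcard : Fintype.card (Fin (m + 1)) = Module.finrank ℝ (TangentSpace I2 ((z, t) : N × ℝ)) := by
    show Fintype.card (Fin (m + 1)) = Module.finrank ℝ (E' × ℝ)
    rw [finrank_cylModel, Fintype.card_fin]
  set γ := basisOfLinearIndependentOfCardEqFinrank hli hcard with hγdef
  have hγ : ∀ k, γ k = e k := fun k ↦
    congrFun (coe_basisOfLinearIndependentOfCardEqFinrank hli hcard) k
  have hγo : (G.toBilinForm (z, t)).IsOrthoᵢ γ := by
    intro k l hkl
    simp only [Function.onFun, hγ]
    exact heo hkl
  have hγd : ∀ k, G.val (z, t) (γ k) (γ k) ≠ 0 := fun k ↦ by rw [hγ]; exact hed k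
  have hM := ricci_eq_sum_of_isOrthoᵢ G (z, t) γ hγo hγd ((u, 0) : TangentSpace I2 (z, t))
    ((u, 0) : TangentSpace I2 (z, t))
  -- the term through `∂_t` vanishes
  have hlast : G.val (z, t) (G.riemann (z, t) (((0 : E'), (1 : ℝ)) : TangentSpace I2 (z, t))
      ((u, 0) : TangentSpace I2 (z, t)) ((u, 0) : TangentSpace I2 (z, t)))
      (((0 : E'), (1 : ℝ)) : TangentSpace I2 (z, t)) = 0 := by
    rw [val_riemann_skew (g := G) (by exact WithTop.coe_le_coe.2 le_top),
      staticCyl_val_riemann_inr_inl_inr_self G hG hcyl hstat z t u, neg_zero]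
  rw [hM, hN, Fin.sum_univ_castSucc]
  simp only [hγ, hec, hel, hlast, zero_div, add_zero]
  refine Finset.sum_congr rfl fun i _ ↦ ?_
  rw [hGauss i, hval]

/-- **`Ric_G((v,0),(w,0)) = Ric_h(v,w)` on a static Riemannian generalized cylinder**
(O'Neill 1983, Ch. 3, Cor. 3.58 (1); Ch. 7, Cor. 7.43 (1) with `f ≡ 1`:
`Ric(X,Y) = {}^B Ric(X,Y)` for horizontal `X, Y`): polarization of
`staticCyl_ricci_inl_inl_self`, both Ricci tensors being symmetric (`ricci_symm_holds`).
[cite: ONeill1983, Ch. 7, Cor. 7.43] -/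
theorem staticCyl_ricci_inl_inl (hG : G.IsRiemannian)
    (hcyl : ∀ (p : N × ℝ) (v w : TangentSpace (I'.prod 𝓘(ℝ, ℝ)) p),
      G.val p v w = G.val p ((v.1, 0) : TangentSpace (I'.prod 𝓘(ℝ, ℝ)) p)
        ((w.1, 0) : TangentSpace (I'.prod 𝓘(ℝ, ℝ)) p) + v.2 * w.2)
    (hstat : ∀ (z : N) (t t' : ℝ) (v w : E'),
      G.val (z, t) ((v, 0) : TangentSpace (I'.prod 𝓘(ℝ, ℝ)) (z, t))
          ((w, 0) : TangentSpace (I'.prod 𝓘(ℝ, ℝ)) (z, t)) =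
        G.val (z, t') ((v, 0) : TangentSpace (I'.prod 𝓘(ℝ, ℝ)) (z, t'))
          ((w, 0) : TangentSpace (I'.prod 𝓘(ℝ, ℝ)) (z, t')))
    (z : N) (t : ℝ) (v w : E') :
    haveI := (G.inducedMetric (fun y : N ↦ ((y, t) : N × ℝ))
      (contMDiff_pullbackBilin_holds (I := I'.prod 𝓘(ℝ, ℝ)) (M := N × ℝ) (I' := I') (N := N))
      (isSpacelikeImmersion_cylSlice G hG t)).hasLeviCivita
    G.ricci (z, t) ((v, 0) : TangentSpace (I'.prod 𝓘(ℝ, ℝ)) (z, t))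
        ((w, 0) : TangentSpace (I'.prod 𝓘(ℝ, ℝ)) (z, t)) =
      (G.inducedMetric (fun y : N ↦ ((y, t) : N × ℝ))
        (contMDiff_pullbackBilin_holds (I := I'.prod 𝓘(ℝ, ℝ)) (M := N × ℝ) (I' := I') (N := N))
        (isSpacelikeImmersion_cylSlice G hG t)).ricci z v w := by
  haveI : CompleteSpace E' := FiniteDimensional.complete ℝ E'
  haveI := (G.inducedMetric (fun y : N ↦ ((y, t) : N × ℝ))
    (contMDiff_pullbackBilin_holds (I := I'.prod 𝓘(ℝ, ℝ)) (M := N × ℝ) (I' := I') (N := N))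
    (isSpacelikeImmersion_cylSlice G hG t)).hasLeviCivita
  have hq := fun u ↦ staticCyl_ricci_inl_inl_self G hG hcyl hstat z t u
  have h2 : (2 : ℕ∞ω) ≤ ∞ := by exact WithTop.coe_le_coe.2 le_top
  -- work with tangent-space typed copies of `v`, `w` (so that additions match `map_add`)
  set a : TangentSpace I' z := v with ha
  set b : TangentSpace I' z := w with hb
  set x : TangentSpace (I'.prod 𝓘(ℝ, ℝ)) (z, t) := (a, 0) with hx
  set y : TangentSpace (I'.prod 𝓘(ℝ, ℝ)) (z, t) := (b, 0) with hy
  have hsG := (ricci_symm_holds (g := G) h2 ((z, t) : N × ℝ)).eq x y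
  have hsN := (ricci_symm_holds (g := G.inducedMetric (fun y : N ↦ ((y, t) : N × ℝ))
    (contMDiff_pullbackBilin_holds (I := I'.prod 𝓘(ℝ, ℝ)) (M := N × ℝ) (I' := I') (N := N))
    (isSpacelikeImmersion_cylSlice G hG t)) h2 z).eq a b
  have hxy : ((a + b, 0) : TangentSpace (I'.prod 𝓘(ℝ, ℝ)) (z, t)) = x + y :=
    Prod.ext rfl (by change (0 : ℝ) = 0 + 0; rw [add_zero])
  have h1 := hq (a + b)
  rw [hxy] at h1
  simp only [map_add, LinearMap.add_apply] at h1
  have hv := hq a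
  have hw := hq b
  linarith

/-! ### Calculus lemmas: constancy from a vanishing differential; the field `∂_t` -/

section Constancy

variable {E : Type*} [NormedAddCommGroup E] [NormedSpace ℝ E] {H : Type*} [TopologicalSpace H]
  {I : ModelWithCorners ℝ E H} [I.Boundaryless] {M : Type*} [TopologicalSpace M]
  [ChartedSpace H M] [IsManifold I ∞ M]

/-- **A `C¹` function with identically vanishing differential on a connected manifold is
constant** (in a chart this is the mean value theorem on a ball, `Convex.is_const_of_fderivWithin_eq_zero`;
then connectedness, `IsLocallyConstant.apply_eq_of_preconnectedSpace`). O'Neill 1983, Ch. 1,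
Exercise 12 (b) (`df = 0` on a connected manifold forces `f` constant). [folklore] -/
theorem apply_eq_apply_of_mfderiv_eq_zero [ConnectedSpace M] {f : M → ℝ}
    (hf : ContMDiff I 𝓘(ℝ, ℝ) 1 f) (h0 : ∀ x, mfderiv I 𝓘(ℝ, ℝ) f x = 0) (x y : M) :
    f x = f y := by
  suffices hloc : IsLocallyConstant f from hloc.apply_eq_of_preconnectedSpace x y
  refine (IsLocallyConstant.iff_eventually_eq f).2 fun x₀ ↦ ?_
  set φ := extChartAt I x₀ with hφ
  set F : E → ℝ := f ∘ φ.symm with hF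
  -- `F` is differentiable with zero derivative on the (open) chart target
  have hFd : ∀ z ∈ φ.target, DifferentiableAt ℝ F z ∧ fderiv ℝ F z = 0 := by
    intro z hz
    have h1 : MDifferentiableAt 𝓘(ℝ, E) I φ.symm z := by
      have := mdifferentiableWithinAt_extChartAt_symm hz
      rwa [ModelWithCorners.Boundaryless.range_eq_univ, mdifferentiableWithinAt_univ] at this
    have h2 : MDifferentiableAt I 𝓘(ℝ, ℝ) f (φ.symm z) := (hf _).mdifferentiableAt one_ne_zero
    have h3 : MDifferentiableAt 𝓘(ℝ, E) 𝓘(ℝ, ℝ) F z := h2.comp z h1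
    have h4 : mfderiv 𝓘(ℝ, E) 𝓘(ℝ, ℝ) F z = 0 := by
      rw [hF, mfderiv_comp z h2 h1, h0]
      exact ContinuousLinearMap.zero_comp _
    refine ⟨mdifferentiableAt_iff_differentiableAt.1 h3, ?_⟩
    rwa [mfderiv_eq_fderiv] at h4
  -- a ball inside the target around `φ x₀`
  obtain ⟨r, hr, hball⟩ := Metric.mem_nhds_iff.1 (extChartAt_target_mem_nhds (I := I) x₀)
  have hconst : ∀ z ∈ Metric.ball (φ x₀) r, F z = F (φ x₀) := by
    intro z hz
    refine (convex_ball (φ x₀) r).is_const_of_fderivWithin_eq_zero (𝕜 := ℝ)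
      (fun w hw ↦ (hFd w (hball hw)).1.differentiableWithinAt) ?_ hz (Metric.mem_ball_self hr)
    intro w hw
    rw [fderivWithin_of_isOpen Metric.isOpen_ball hw]
    exact (hFd w (hball hw)).2
  -- pull back to the manifold
  have hsrc : ∀ᶠ y in 𝓝 x₀, y ∈ φ.source := extChartAt_source_mem_nhds (I := I) x₀
  have hpre : ∀ᶠ y in 𝓝 x₀, φ y ∈ Metric.ball (φ x₀) r :=
    (continuousAt_extChartAt (I := I) x₀).preimage_mem_nhds (Metric.ball_mem_nhds _ hr)
  filter_upwards [hsrc, hpre] with y hy hyb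
  have e1 : f y = F (φ y) := by
    simp only [hF, Function.comp_apply, φ.left_inv hy]
  have e2 : f x₀ = F (φ x₀) := by
    simp only [hF, Function.comp_apply, φ.left_inv (mem_extChartAt_source (I := I) x₀)]
  rw [e1, e2, hconst _ hyb]

end Constancy

/-! ### The unit field `∂_t` on `N × ℝ` and derivatives of a function along the `t`-lines -/

omit [FiniteDimensional ℝ E'] [I'.Boundaryless] [IsManifold I' ∞ N] in
/-- The field `∂_t`, written as the partial velocity `q ↦ velocity (s ↦ (q.1, s)) q.2` of the
identity family, is `(0, 1)` at every point (`velocity_cylLine`). [folklore] -/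
theorem cyl_dtField_eq (q : N × ℝ) :
    velocity (I'.prod 𝓘(ℝ, ℝ)) (fun s : ℝ ↦ ((q.1, s) : N × ℝ)) q.2 =
      (((0 : E'), (1 : ℝ)) : TangentSpace (I'.prod 𝓘(ℝ, ℝ)) q) := by
  obtain ⟨y, t⟩ := q
  exact velocity_cylLine y t

omit [FiniteDimensional ℝ E'] in
/-- **`∂_t` is a smooth vector field on `N × ℝ`**: its lift `q ↦ (q, ∂_t) ∈ T(N × ℝ)` is `C^∞`
(`contMDiffAt_lift_partialVelocity` for the identity family). [folklore] -/
theorem cyl_contMDiff_lift_dtField :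
    ContMDiff (I'.prod 𝓘(ℝ, ℝ)) (I'.prod 𝓘(ℝ, ℝ)).tangent ∞ (fun q : N × ℝ ↦
      (TotalSpace.mk' (E' × ℝ) q (velocity (I'.prod 𝓘(ℝ, ℝ)) (fun s : ℝ ↦ ((q.1, s) : N × ℝ)) q.2) :
        TangentBundle (I'.prod 𝓘(ℝ, ℝ)) (N × ℝ))) := by
  rintro ⟨y, t⟩
  exact contMDiffAt_lift_partialVelocity (I := I'.prod 𝓘(ℝ, ℝ)) (f := fun q : N × ℝ ↦ q)
    (eventually_contMDiffAt_id_cyl (I' := I') ((y, t) : N × ℝ))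

omit [FiniteDimensional ℝ E'] [I'.Boundaryless] [IsManifold I' ∞ N] [G.HasLeviCivita] in
/-- **`∂_t F(z, t) = dF_{(z,t)}(∂_t)`**: the restriction of a differentiable `F : N × ℝ → ℝ` to the
`t`-line through `z` has derivative `dF(0, 1)` (chain rule, `hasDerivAt_comp_curve_mvfderiv`).
[folklore] -/
theorem cyl_hasDerivAt_apply_line {F : N × ℝ → ℝ} {z : N} {t : ℝ}
    (hF : MDifferentiableAt (I'.prod 𝓘(ℝ, ℝ)) 𝓘(ℝ, ℝ) F (z, t)) :
    HasDerivAt (fun τ : ℝ ↦ F (z, τ))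
      (mvfderiv (I'.prod 𝓘(ℝ, ℝ)) F (z, t)
        (((0 : E'), (1 : ℝ)) : TangentSpace (I'.prod 𝓘(ℝ, ℝ)) (z, t))) t := by
  have h := hasDerivAt_comp_curve_mvfderiv (I := I'.prod 𝓘(ℝ, ℝ)) (γ := fun τ : ℝ ↦ ((z, τ) : N × ℝ))
    (t := t) hF ((contMDiff_cylLine z t).mdifferentiableAt (by simp))
  rw [velocity_cylLine] at h
  exact h

/-- **`∂_t (dF(∂_t)) = Hess F(∂_t, ∂_t)` along the `t`-lines of a generalized cylinder**: for
`F` of class `C²`, the function `τ ↦ dF_{(z,τ)}(∂_t)` has derivative `Hess_G F(∂_t, ∂_t)(z, t)` at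
`t` — `(f ∘ γ)'' = Hess f(γ', γ') + df(D_t γ')` (`hasDerivAt_mvfderiv_apply_along`) and the
`t`-lines are geodesics (`covariantDerivAlong_velocity_cylLine`). O'Neill 1983, Ch. 3, Lemma 3.49.
[cite: ONeill1983, Ch. 3, Lemma 3.49] -/
theorem cyl_hasDerivAt_mvfderiv_dt
    (hcyl : ∀ (p : N × ℝ) (v w : TangentSpace (I'.prod 𝓘(ℝ, ℝ)) p),
      G.val p v w = G.val p ((v.1, 0) : TangentSpace (I'.prod 𝓘(ℝ, ℝ)) p)
        ((w.1, 0) : TangentSpace (I'.prod 𝓘(ℝ, ℝ)) p) + v.2 * w.2)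
    {F : N × ℝ → ℝ} (hF : ContMDiff (I'.prod 𝓘(ℝ, ℝ)) 𝓘(ℝ, ℝ) 2 F) (z : N) (t : ℝ) :
    HasDerivAt (fun τ : ℝ ↦ mvfderiv (I'.prod 𝓘(ℝ, ℝ)) F (z, τ)
        (((0 : E'), (1 : ℝ)) : TangentSpace (I'.prod 𝓘(ℝ, ℝ)) (z, τ)))
      (G.hessian F (z, t) (((0 : E'), (1 : ℝ)) : TangentSpace (I'.prod 𝓘(ℝ, ℝ)) (z, t))
        (((0 : E'), (1 : ℝ)) : TangentSpace (I'.prod 𝓘(ℝ, ℝ)) (z, t))) t := by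
  haveI : CompleteSpace E' := FiniteDimensional.complete ℝ E'
  set I2 := I'.prod 𝓘(ℝ, ℝ) with hI2
  set γ : ℝ → N × ℝ := fun τ ↦ (z, τ) with hγ
  have hlift : MDifferentiableAt 𝓘(ℝ, ℝ) I2.tangent
      (fun τ ↦ (TotalSpace.mk' (E' × ℝ) (γ τ) (velocity I2 γ τ) : TangentBundle I2 (N × ℝ))) t :=
    ((contMDiff_lift_velocity_of_contMDiff (contMDiff_cylLine z)) t).mdifferentiableAt (by simp)
  have h := hasDerivAt_mvfderiv_apply_along G (γ := γ) (W := fun τ ↦ velocity I2 γ τ) (t₀ := t)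
    (hF (γ t)) hlift
  rw [covariantDerivAlong_velocity_cylLine G hcyl z t, map_zero, add_zero] at h
  have hfun : (fun τ ↦ mvfderiv I2 F (γ τ) (velocity I2 γ τ)) = fun τ : ℝ ↦ mvfderiv I2 F (z, τ)
      (((0 : E'), (1 : ℝ)) : TangentSpace I2 (z, τ)) := by
    funext τ
    rw [velocity_cylLine]
  rw [hfun, velocity_cylLine] at h
  exact h

/-! ### Gradient shrinkers on a static cylinder: `∂_t F` is constant along the slices -/

/-- **On a static Riemannian generalized cylinder carrying a gradient shrinker structure
`Ric_G + Hess_G F = G/2`, the function `∂_t F = dF(∂_t)` is constant along every slice**: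
`d(y ↦ dF_{(y,t)}(∂_t))_y(v) = 0`. Along the chart-straight curve `c` of `N` through `y` with
velocity `v`, `(d/ds) dF_{(c s, t)}(∂_t) = Hess F((v,0), ∂_t) + dF(D_{(v,0)} ∂_t)`
(`hasDerivAt_mvfderiv_apply_along`); `D_{(v,0)} ∂_t = 0` (`staticCyl_normalDerivAlong_eq_zero`)
and `Hess F((v,0), ∂_t) = ½ G((v,0), ∂_t) - Ric((v,0), ∂_t) = 0` (`staticCyl_ricci_inr_inl`).
This is the computation behind "the potential has the form `f(x, y) = f̃(x) + ¼|y - y₀|²` after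
splitting isometrically" (Haslhofer–Müller 2011, §2, p. 5; Naber 2010, proof of Lemma 2.1;
Petersen–Wylie 2009). [cite: HaslhoferMuller2011, §2 (p. 5)] -/
theorem staticCyl_mvfderiv_dt_potential_eq_zero (hG : G.IsRiemannian)
    (hcyl : ∀ (p : N × ℝ) (v w : TangentSpace (I'.prod 𝓘(ℝ, ℝ)) p),
      G.val p v w = G.val p ((v.1, 0) : TangentSpace (I'.prod 𝓘(ℝ, ℝ)) p)
        ((w.1, 0) : TangentSpace (I'.prod 𝓘(ℝ, ℝ)) p) + v.2 * w.2)
    (hstat : ∀ (z : N) (t t' : ℝ) (v w : E'),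
      G.val (z, t) ((v, 0) : TangentSpace (I'.prod 𝓘(ℝ, ℝ)) (z, t))
          ((w, 0) : TangentSpace (I'.prod 𝓘(ℝ, ℝ)) (z, t)) =
        G.val (z, t') ((v, 0) : TangentSpace (I'.prod 𝓘(ℝ, ℝ)) (z, t'))
          ((w, 0) : TangentSpace (I'.prod 𝓘(ℝ, ℝ)) (z, t')))
    {F : N × ℝ → ℝ} (hF : ContMDiff (I'.prod 𝓘(ℝ, ℝ)) 𝓘(ℝ, ℝ) ∞ F)
    (hsol : ∀ (p : N × ℝ) (X Y : TangentSpace (I'.prod 𝓘(ℝ, ℝ)) p),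
      G.ricci p X Y + G.hessian F p X Y = (1 / 2 : ℝ) * G.val p X Y)
    (y : N) (t : ℝ) (v : E') :
    mvfderiv I' (fun y' : N ↦ mvfderiv (I'.prod 𝓘(ℝ, ℝ)) F (y', t)
        (((0 : E'), (1 : ℝ)) : TangentSpace (I'.prod 𝓘(ℝ, ℝ)) (y', t))) y v = 0 := by
  haveI : CompleteSpace E' := FiniteDimensional.complete ℝ E'
  set I2 := I'.prod 𝓘(ℝ, ℝ) with hI2
  have hF2 : ∀ q, CMDiffAt 2 F q := fun q ↦ (hF q).of_le (by exact WithTop.coe_le_coe.2 le_top)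
  have hFd : ∀ q, MDifferentiableAt I2 𝓘(ℝ, ℝ) F q := fun q ↦ (hF q).mdifferentiableAt (by simp)
  -- the field `∂_t` and the function `u = dF(∂_t)`
  set T : Π q : N × ℝ, TangentSpace I2 q := fun q ↦
    velocity I2 (fun s : ℝ ↦ ((q.1, s) : N × ℝ)) q.2 with hT_def
  have hT : ∀ q, T q = (((0 : E'), (1 : ℝ)) : TangentSpace I2 q) := fun q ↦ cyl_dtField_eq q
  have hTs : ContMDiff I2 I2.tangent ∞ (fun q : N × ℝ ↦
      (TotalSpace.mk' (E' × ℝ) q (T q) : TangentBundle I2 (N × ℝ))) := cyl_contMDiff_lift_dtField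
  set u : N × ℝ → ℝ := fun q ↦ mvfderiv I2 F q (T q) with hu_def
  have hu1 : ∀ q, CMDiffAt 1 u q := fun q ↦
    contMDiffAt_mvfderiv_apply (hF2 q) ((hTs q).of_le (by exact WithTop.coe_le_coe.2 le_top))
  -- the slice function `k = u ∘ ι_t`
  set k : N → ℝ := fun y' ↦ mvfderiv I2 F (y', t) (((0 : E'), (1 : ℝ)) : TangentSpace I2 (y', t))
    with hk_def
  have hku : k = u ∘ fun y' : N ↦ ((y', t) : N × ℝ) := by
    funext y'
    simp only [hk_def, hu_def, Function.comp_apply, hT]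
  have hkd : ∀ y', MDifferentiableAt I' 𝓘(ℝ, ℝ) k y' := fun y' ↦ by
    rw [hku]
    exact ((hu1 _).mdifferentiableAt one_ne_zero).comp y'
      ((contMDiff_cylSlice t y').mdifferentiableAt (by simp))
  -- the horizontal chart curve `c` through `y` and its image `γ` in the slice
  set c : ℝ → N := curveThrough I' y v with hc_def
  set γ : ℝ → N × ℝ := fun s ↦ (c s, t) with hγ_def
  have hc0 : c 0 = y := curveThrough_zero I' y v
  have hγ0 : γ 0 = ((y, t) : N × ℝ) := Prod.ext hc0 rfl
  have hcd : MDifferentiableAt 𝓘(ℝ, ℝ) I' c 0 :=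
    (contMDiffAt_curveThrough_zero (n := 1) y v).mdifferentiableAt one_ne_zero
  have hγd : MDifferentiableAt 𝓘(ℝ, ℝ) I2 γ 0 :=
    ((contMDiff_cylSlice t (c 0)).mdifferentiableAt (by simp)).comp 0 hcd
  have hvc : velocity I' c 0 = v := velocity_curveThrough_zero_holds BoundarylessManifold.isInteriorPoint v
  have hvγ : (velocity I2 γ 0 : E' × ℝ) = (v, 0) :=
    (velocity_family_curveThrough (I := I2) (F := fun q : N × ℝ ↦ q) (z := y) (τ := t)
      (contMDiff_cylSlice (I' := I') t y) v).trans (mfderiv_cylSlice_apply y t v)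
  -- (a) derivative of `s ↦ dF_{γ s}(∂_t)` by the along-curve Hessian formula
  have hWlift : MDifferentiableAt 𝓘(ℝ, ℝ) I2.tangent
      (fun s ↦ (TotalSpace.mk' (E' × ℝ) (γ s) (T (γ s)) : TangentBundle I2 (N × ℝ))) 0 :=
    ((hTs (γ 0)).mdifferentiableAt (by simp)).comp 0 hγd
  have ha := hasDerivAt_mvfderiv_apply_along G (γ := γ) (W := fun s ↦ T (γ s)) (t₀ := 0)
    (hF2 (γ 0)) hWlift
  -- (b) `D_s (∂_t ∘ γ) = D_v ∂_t = 0`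
  have hb : covariantDerivAlong G.leviCivita γ (fun s ↦ T (γ s)) 0 = 0 := by
    have h := staticCyl_normalDerivAlong_eq_zero G hG hcyl hstat y t v
    exact h
  -- (d) `Hess F(γ' 0, ∂_t) = 0`
  have hd : G.hessian F (γ 0) (velocity I2 γ 0) (T (γ 0)) = 0 := by
    have key : ∀ (q : N × ℝ) (X : TangentSpace I2 q), q = ((y, t) : N × ℝ) → (X : E' × ℝ) = (v, 0) →
        G.hessian F q X (T q) = 0 := by
      rintro q X rfl hX
      have hX' : X = ((v, 0) : TangentSpace I2 (y, t)) := hX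
      rw [hX', hT]
      have h1 := hsol ((y, t) : N × ℝ) ((v, 0) : TangentSpace I2 (y, t))
        (((0 : E'), (1 : ℝ)) : TangentSpace I2 (y, t))
      have h2 : (2 : ℕ∞ω) ≤ ∞ := by exact WithTop.coe_le_coe.2 le_top
      have hRs := (ricci_symm_holds (g := G) h2 ((y, t) : N × ℝ)).eq
        ((v, 0) : TangentSpace I2 (y, t)) (((0 : E'), (1 : ℝ)) : TangentSpace I2 (y, t))
      rw [hRs, staticCyl_ricci_inr_inl G hcyl hstat y t v, cyl_val_inl_inr G hcyl (y, t) v] at h1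
      linarith
    exact key (γ 0) (velocity I2 γ 0) hγ0 hvγ
  rw [hb, hd, map_zero, zero_add] at ha
  -- so `s ↦ k (c s)` has derivative `0` at `s = 0`
  have ha' : HasDerivAt (fun s ↦ k (c s)) 0 0 := by
    refine ha.congr_of_eventuallyEq (Eventually.of_forall fun s ↦ ?_)
    show k (c s) = mvfderiv I2 F (γ s) (T (γ s))
    rw [hT]
  -- (e) the chain rule: the same derivative is `dk_y(v)`
  have he : HasDerivAt (fun s ↦ k (c s)) (mvfderiv I' k (c 0) (velocity I' c 0)) 0 :=
    hasDerivAt_comp_curve_mvfderiv (hkd (c 0)) hcd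
  rw [hvc] at he
  have huniq := he.unique ha'
  have key2 : ∀ y'' : N, y'' = y → mvfderiv I' k y'' v = 0 → mvfderiv I' k y v = 0 := by
    rintro y'' rfl h; exact h
  exact key2 (c 0) hc0 huniq

omit [FiniteDimensional ℝ E'] [G.HasLeviCivita] in
/-- `q ↦ dF_q(∂_t)` is `C¹` on `N × ℝ` for `F` of class `C^∞` (`contMDiffAt_mvfderiv_apply` with the
smooth field `∂_t`, `cyl_contMDiff_lift_dtField`). [folklore] -/
theorem cyl_contMDiff_mvfderiv_dt {F : N × ℝ → ℝ} (hF : ContMDiff (I'.prod 𝓘(ℝ, ℝ)) 𝓘(ℝ, ℝ) ∞ F) :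
    ContMDiff (I'.prod 𝓘(ℝ, ℝ)) 𝓘(ℝ, ℝ) 1 (fun q : N × ℝ ↦ mvfderiv (I'.prod 𝓘(ℝ, ℝ)) F q
      (((0 : E'), (1 : ℝ)) : TangentSpace (I'.prod 𝓘(ℝ, ℝ)) q)) := by
  set I2 := I'.prod 𝓘(ℝ, ℝ) with hI2
  have hfun : (fun q : N × ℝ ↦ mvfderiv I2 F q (((0 : E'), (1 : ℝ)) : TangentSpace I2 q)) =
      fun q ↦ mvfderiv I2 F q (velocity I2 (fun s : ℝ ↦ ((q.1, s) : N × ℝ)) q.2) := by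
    funext q
    rw [cyl_dtField_eq]
  rw [hfun]
  intro q
  exact contMDiffAt_mvfderiv_apply ((hF q).of_le (by exact WithTop.coe_le_coe.2 le_top))
    ((cyl_contMDiff_lift_dtField q).of_le (by exact WithTop.coe_le_coe.2 le_top))

/-- **Splitting of the potential of a gradient shrinker on a static cylinder** (Haslhofer–Müller
2011, §2, p. 5: "the potential has the form `f(x, y) = f̃(x) + ¼|y - y₀|²` after splitting
`M ≅ M̃ × ℝᵏ` isometrically"; Naber 2010, proof of Lemma 2.1; Petersen–Wylie 2009, §2). On a
connected static Riemannian generalized cylinder `(N × ℝ, G = h + dt²)` let `F` be smooth with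
`Ric_G + Hess_G F = G/2`. Then there is `t₀` with `∂_t F(z, t) = (t - t₀)/2` and
`F(z, t) = F(z, t₀) + (t - t₀)²/4` for all `z, t`. Proof: `u = ∂_t F` is constant along the slices
(`staticCyl_mvfderiv_dt_potential_eq_zero`, `apply_eq_apply_of_mfderiv_eq_zero`) and
`∂_t u = Hess F(∂_t, ∂_t) = ½ - Ric(∂_t, ∂_t) = ½` (`cyl_hasDerivAt_mvfderiv_dt`,
`staticCyl_ricci_inr_inr`); integrate twice in `t`. [cite: HaslhoferMuller2011, §2 (p. 5)] -/
theorem staticCyl_potential_split [ConnectedSpace N] (hG : G.IsRiemannian)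
    (hcyl : ∀ (p : N × ℝ) (v w : TangentSpace (I'.prod 𝓘(ℝ, ℝ)) p),
      G.val p v w = G.val p ((v.1, 0) : TangentSpace (I'.prod 𝓘(ℝ, ℝ)) p)
        ((w.1, 0) : TangentSpace (I'.prod 𝓘(ℝ, ℝ)) p) + v.2 * w.2)
    (hstat : ∀ (z : N) (t t' : ℝ) (v w : E'),
      G.val (z, t) ((v, 0) : TangentSpace (I'.prod 𝓘(ℝ, ℝ)) (z, t))
          ((w, 0) : TangentSpace (I'.prod 𝓘(ℝ, ℝ)) (z, t)) =
        G.val (z, t') ((v, 0) : TangentSpace (I'.prod 𝓘(ℝ, ℝ)) (z, t'))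
          ((w, 0) : TangentSpace (I'.prod 𝓘(ℝ, ℝ)) (z, t')))
    {F : N × ℝ → ℝ} (hF : ContMDiff (I'.prod 𝓘(ℝ, ℝ)) 𝓘(ℝ, ℝ) ∞ F)
    (hsol : ∀ (p : N × ℝ) (X Y : TangentSpace (I'.prod 𝓘(ℝ, ℝ)) p),
      G.ricci p X Y + G.hessian F p X Y = (1 / 2 : ℝ) * G.val p X Y) :
    ∃ t₀ : ℝ,
      (∀ (z : N) (t : ℝ), mvfderiv (I'.prod 𝓘(ℝ, ℝ)) F (z, t)
        (((0 : E'), (1 : ℝ)) : TangentSpace (I'.prod 𝓘(ℝ, ℝ)) (z, t)) = (t - t₀) / 2) ∧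
      ∀ (z : N) (t : ℝ), F (z, t) = F (z, t₀) + (t - t₀) ^ 2 / 4 := by
  set I2 := I'.prod 𝓘(ℝ, ℝ) with hI2
  have hF2 : ContMDiff I2 𝓘(ℝ, ℝ) 2 F := hF.of_le (by exact WithTop.coe_le_coe.2 le_top)
  have hFd : ∀ q, MDifferentiableAt I2 𝓘(ℝ, ℝ) F q := fun q ↦ (hF q).mdifferentiableAt (by simp)
  -- `u = ∂_t F`
  set u : N × ℝ → ℝ := fun q ↦ mvfderiv I2 F q (((0 : E'), (1 : ℝ)) : TangentSpace I2 q) with hu_def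
  have hu1 : ContMDiff I2 𝓘(ℝ, ℝ) 1 u := cyl_contMDiff_mvfderiv_dt hF
  -- (1) `u` is constant along the slices
  have hslice : ∀ (t : ℝ) (y y' : N), u (y, t) = u (y', t) := by
    intro t y y'
    have hk1 : ContMDiff I' 𝓘(ℝ, ℝ) 1 (fun y : N ↦ u (y, t)) := fun y ↦
      (hu1 _).comp y ((contMDiff_cylSlice t y).of_le (by exact WithTop.coe_le_coe.2 le_top))
    have hk0 : ∀ y : N, mfderiv I' 𝓘(ℝ, ℝ) (fun y : N ↦ u (y, t)) y = 0 := fun y ↦ by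
      ext v
      change mvfderiv I' (fun y : N ↦ u (y, t)) y v = 0
      exact staticCyl_mvfderiv_dt_potential_eq_zero G hG hcyl hstat hF hsol y t v
    exact apply_eq_apply_of_mfderiv_eq_zero hk1 hk0 y y'
  -- (2) `∂_t u = ½` along every `t`-line
  have hline : ∀ (z : N) (t : ℝ), HasDerivAt (fun τ : ℝ ↦ u (z, τ)) (1 / 2) t := by
    intro z t
    have h := cyl_hasDerivAt_mvfderiv_dt G hcyl hF2 z t
    have hH : G.hessian F (z, t) (((0 : E'), (1 : ℝ)) : TangentSpace I2 (z, t))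
        (((0 : E'), (1 : ℝ)) : TangentSpace I2 (z, t)) = 1 / 2 := by
      have h1 := hsol ((z, t) : N × ℝ) (((0 : E'), (1 : ℝ)) : TangentSpace I2 (z, t))
        (((0 : E'), (1 : ℝ)) : TangentSpace I2 (z, t))
      rw [staticCyl_ricci_inr_inr G hG hcyl hstat z t, cyl_val_inr_inr G hcyl (z, t)] at h1
      linarith
    rw [hH] at h
    exact h
  -- (3) integrate: `u (z, t) = u (z₀, 0) + t/2`
  obtain ⟨z₀⟩ := (inferInstance : Nonempty N)
  set t₀ : ℝ := -2 * u (z₀, 0) with ht₀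
  have hu : ∀ (z : N) (t : ℝ), u (z, t) = (t - t₀) / 2 := by
    intro z t
    have hg : ∀ τ, HasDerivAt (fun τ : ℝ ↦ u (z₀, τ) - τ / 2) 0 τ := fun τ ↦
      ((hline z₀ τ).sub ((hasDerivAt_id' τ).div_const 2)).congr_deriv (sub_self _)
    have hdiff : Differentiable ℝ (fun τ : ℝ ↦ u (z₀, τ) - τ / 2) := fun τ ↦ (hg τ).differentiableAt
    have hconst := is_const_of_deriv_eq_zero hdiff (fun τ ↦ (hg τ).deriv) t 0
    rw [hslice t z z₀]
    simp only [zero_div, sub_zero] at hconst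
    rw [ht₀]
    linarith
  refine ⟨t₀, hu, fun z t ↦ ?_⟩
  -- (4) integrate once more: `F (z, t) - (t - t₀)²/4` is constant in `t`
  have hg : ∀ τ, HasDerivAt (fun τ : ℝ ↦ F (z, τ) - (τ - t₀) ^ 2 / 4) 0 τ := fun τ ↦ by
    have h1 : HasDerivAt (fun τ : ℝ ↦ F (z, τ)) (u (z, τ)) τ := cyl_hasDerivAt_apply_line (hFd _)
    have h2 : HasDerivAt (fun τ : ℝ ↦ (τ - t₀) ^ 2 / 4) ((τ - t₀) / 2) τ := by
      refine ((((hasDerivAt_id' τ).sub_const t₀).pow 2).div_const 4).congr_deriv ?_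
      rw [show (2 : ℕ) - 1 = 1 from rfl, pow_one, mul_one, Nat.cast_ofNat]
      ring
    refine (h1.sub h2).congr_deriv ?_
    rw [hu z τ, sub_self]
  have hdiff : Differentiable ℝ (fun τ : ℝ ↦ F (z, τ) - (τ - t₀) ^ 2 / 4) := fun τ ↦
    (hg τ).differentiableAt
  have hconst := is_const_of_deriv_eq_zero hdiff (fun τ ↦ (hg τ).deriv) t t₀
  simp only [sub_self] at hconst
  linarith

/-! ### Hessian and gradient of a function restricted to a slice -/

/-- **The Hessian of a function restricted to a slice of a static cylinder is the horizontal
Hessian**: `Hess_{g_t}(F ∘ ι_t)(v, w) = Hess_G F((v,0),(w,0))` (`hessian_comp_apply`, O'Neill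
1983, Ch. 4, Lemma 4.3–4.4, with `K_t = 0`). [cite: ONeill1983, Ch. 4, Lemma 4.4] -/
theorem staticCyl_hessian_slice (hG : G.IsRiemannian)
    (hcyl : ∀ (p : N × ℝ) (v w : TangentSpace (I'.prod 𝓘(ℝ, ℝ)) p),
      G.val p v w = G.val p ((v.1, 0) : TangentSpace (I'.prod 𝓘(ℝ, ℝ)) p)
        ((w.1, 0) : TangentSpace (I'.prod 𝓘(ℝ, ℝ)) p) + v.2 * w.2)
    (hstat : ∀ (z : N) (t t' : ℝ) (v w : E'),
      G.val (z, t) ((v, 0) : TangentSpace (I'.prod 𝓘(ℝ, ℝ)) (z, t))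
          ((w, 0) : TangentSpace (I'.prod 𝓘(ℝ, ℝ)) (z, t)) =
        G.val (z, t') ((v, 0) : TangentSpace (I'.prod 𝓘(ℝ, ℝ)) (z, t'))
          ((w, 0) : TangentSpace (I'.prod 𝓘(ℝ, ℝ)) (z, t')))
    {F : N × ℝ → ℝ} (hF : ContMDiff (I'.prod 𝓘(ℝ, ℝ)) 𝓘(ℝ, ℝ) 2 F) (z : N) (t : ℝ) (v w : E') :
    haveI := (G.inducedMetric (fun y : N ↦ ((y, t) : N × ℝ))
      (contMDiff_pullbackBilin_holds (I := I'.prod 𝓘(ℝ, ℝ)) (M := N × ℝ) (I' := I') (N := N))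
      (isSpacelikeImmersion_cylSlice G hG t)).hasLeviCivita
    (G.inducedMetric (fun y : N ↦ ((y, t) : N × ℝ))
        (contMDiff_pullbackBilin_holds (I := I'.prod 𝓘(ℝ, ℝ)) (M := N × ℝ) (I' := I') (N := N))
        (isSpacelikeImmersion_cylSlice G hG t)).hessian (fun y : N ↦ F (y, t)) z v w =
      G.hessian F (z, t) ((v, 0) : TangentSpace (I'.prod 𝓘(ℝ, ℝ)) (z, t))
        ((w, 0) : TangentSpace (I'.prod 𝓘(ℝ, ℝ)) (z, t)) := by
  haveI : CompleteSpace E' := FiniteDimensional.complete ℝ E'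
  haveI := (G.inducedMetric (fun y : N ↦ ((y, t) : N × ℝ))
    (contMDiff_pullbackBilin_holds (I := I'.prod 𝓘(ℝ, ℝ)) (M := N × ℝ) (I' := I') (N := N))
    (isSpacelikeImmersion_cylSlice G hG t)).hasLeviCivita
  have h := hessian_comp_apply G
    (contMDiff_pullbackBilin_holds (I := I'.prod 𝓘(ℝ, ℝ)) (M := N × ℝ) (I' := I') (N := N))
    (isSpacelikeImmersion_cylSlice G hG t) (contMDiff_lift_velocity_cylSlice t)
    (isUnitNormal_cylSlice G hcyl t) one_ne_zero finrank_cylModel hF z v w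
  rw [staticCyl_secondFundamentalForm_eq_zero G hcyl hstat z t v w, mul_zero, sub_zero,
    mfderiv_cylSlice_apply, mfderiv_cylSlice_apply] at h
  exact h

omit [I'.Boundaryless] [G.HasLeviCivita] in
/-- **The gradient square splits on a generalized cylinder**:
`|∇F|²_G(z, t) = |∇(F ∘ ι_t)|²_{g_t}(z) + (dF(∂_t))²` — the musical isomorphism of the block
metric `G = g_t + dt²` is `♯_G α = (♯_{g_t}(α ∘ dι_t), α(∂_t))`. O'Neill 1983, Ch. 3, p. 60
(metrically equivalent vectors and covectors) for a product metric. [cite: ONeill1983, Ch. 3, p. 60] -/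
theorem cyl_gradSq_eq (hG : G.IsRiemannian)
    (hcyl : ∀ (p : N × ℝ) (v w : TangentSpace (I'.prod 𝓘(ℝ, ℝ)) p),
      G.val p v w = G.val p ((v.1, 0) : TangentSpace (I'.prod 𝓘(ℝ, ℝ)) p)
        ((w.1, 0) : TangentSpace (I'.prod 𝓘(ℝ, ℝ)) p) + v.2 * w.2)
    {F : N × ℝ → ℝ} {z : N} {t : ℝ}
    (hF : MDifferentiableAt (I'.prod 𝓘(ℝ, ℝ)) 𝓘(ℝ, ℝ) F (z, t)) :
    G.gradSq F (z, t) =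
      (G.inducedMetric (fun y : N ↦ ((y, t) : N × ℝ))
        (contMDiff_pullbackBilin_holds (I := I'.prod 𝓘(ℝ, ℝ)) (M := N × ℝ) (I' := I') (N := N))
        (isSpacelikeImmersion_cylSlice G hG t)).gradSq (fun y : N ↦ F (y, t)) z +
      mvfderiv (I'.prod 𝓘(ℝ, ℝ)) F (z, t) (((0 : E'), (1 : ℝ)) : TangentSpace (I'.prod 𝓘(ℝ, ℝ)) (z, t)) ^ 2 := by
  set I2 := I'.prod 𝓘(ℝ, ℝ) with hI2
  set gN := G.inducedMetric (fun y : N ↦ ((y, t) : N × ℝ))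
    (contMDiff_pullbackBilin_holds (I := I2) (M := N × ℝ) (I' := I') (N := N))
    (isSpacelikeImmersion_cylSlice G hG t) with hgN
  have hval : ∀ a b : E', gN.val z a b =
      G.val (z, t) ((a, 0) : TangentSpace I2 (z, t)) ((b, 0) : TangentSpace I2 (z, t)) := by
    intro a b
    rw [hgN, inducedMetric_val, inducedBilin_apply, mfderiv_cylSlice_apply, mfderiv_cylSlice_apply]
  set α : TangentSpace I2 (z, t) →L[ℝ] ℝ := mvfderiv I2 F (z, t) with hα
  set α' : TangentSpace I' z →L[ℝ] ℝ := mvfderiv I' (fun y : N ↦ F (y, t)) z with hα'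
  have hα'v : ∀ v : E', α' v = α ((v, 0) : TangentSpace I2 (z, t)) := fun v ↦ by
    have h := mvfderiv_comp_apply (Φ := fun y : N ↦ ((y, t) : N × ℝ)) (f := F) hF
      ((contMDiff_cylSlice t z).mdifferentiableAt (by simp)) v
    rw [mfderiv_cylSlice_apply] at h
    exact h
  -- the candidate for `♯_G α`: `S = (♯_{g_t} α', α(∂_t))`
  set a₀ : E' := (gN.sharp z (α' : TangentSpace I' z →ₗ[ℝ] ℝ) : E') with ha₀
  set b : TangentSpace I2 (z, t) := ((0 : E'), (1 : ℝ)) with hb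
  set c₀ : ℝ := α b with hc₀
  set S : TangentSpace I2 (z, t) := (a₀, c₀) with hS
  set a₁ : TangentSpace I2 (z, t) := (a₀, (0 : ℝ)) with ha₁
  have hSval : ∀ w : TangentSpace I2 (z, t), G.val (z, t) S w = α w := by
    rintro ⟨w₁, w₂⟩
    set aw : TangentSpace I2 (z, t) := (w₁, (0 : ℝ)) with haw
    have step1 : G.val (z, t) S ((w₁, w₂) : TangentSpace I2 (z, t)) =
        G.val (z, t) a₁ aw + c₀ * w₂ := hcyl (z, t) S _
    have step2 : G.val (z, t) a₁ aw = α aw := by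
      rw [ha₁, haw, ← hval]
      show gN.val z (gN.sharp z (α' : TangentSpace I' z →ₗ[ℝ] ℝ)) w₁ = _
      rw [val_sharp_apply]
      exact hα'v w₁
    have hw : ((w₁, w₂) : TangentSpace I2 (z, t)) = aw + w₂ • b :=
      Prod.ext (show w₁ = w₁ + w₂ • (0 : E') by rw [smul_zero, add_zero])
        (show w₂ = (0 : ℝ) + w₂ • (1 : ℝ) by rw [smul_eq_mul, mul_one, zero_add])
    have step3 : α ((w₁, w₂) : TangentSpace I2 (z, t)) = α aw + w₂ * α b := by
      rw [hw, map_add, map_smul, smul_eq_mul]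
    rw [step1, step2, step3, hc₀, mul_comm]
  have hsharp : G.sharp (z, t) (α : TangentSpace I2 (z, t) →ₗ[ℝ] ℝ) = S := by
    have h0 : G.sharp (z, t) (α : TangentSpace I2 (z, t) →ₗ[ℝ] ℝ) - S = 0 :=
      G.nondegenerate (z, t) _ fun w ↦ by
        rw [map_sub, sub_apply, val_sharp_apply, hSval,
          ContinuousLinearMap.coe_coe, sub_self]
    exact sub_eq_zero.mp h0
  rw [gradSq_eq, gradSq_eq, hsharp]
  show α S = α' a₀ + c₀ ^ 2
  have hS' : S = a₁ + c₀ • b :=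
    Prod.ext (show a₀ = a₀ + c₀ • (0 : E') by rw [smul_zero, add_zero])
      (show c₀ = (0 : ℝ) + c₀ • (1 : ℝ) by rw [smul_eq_mul, mul_one, zero_add])
  have e1 : α S = α a₁ + c₀ * α b := by rw [hS', map_add, map_smul, smul_eq_mul]
  have e2 : α a₁ = α' a₀ := (hα'v a₀).symm
  rw [e1, e2, ← hc₀, sq]

/-! ### The slices of a static cylinder shrinker are shrinkers (Step 5 of the printed chain) -/

/-- **The slices of a gradient shrinker on a static cylinder are gradient shrinkers**: if
`Ric_G + Hess_G F = G/2` on a static Riemannian generalized cylinder `(N × ℝ, G = h + dt²)`, then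
for every `t` the slice `(N, g_t = ι_t^*G, F ∘ ι_t)` satisfies `Ric + Hess(F ∘ ι_t) = g_t/2`
(`staticCyl_ricci_inl_inl`, `staticCyl_hessian_slice`). Haslhofer–Müller 2011, §2, p. 5
("`(M̃, g̃, f̃)` is again a gradient shrinker"); Petersen–Wylie 2009, §2; Naber 2010, Lemma 2.1.
[cite: HaslhoferMuller2011, §2 (p. 5)] -/
theorem staticCyl_slice_soliton (hG : G.IsRiemannian)
    (hcyl : ∀ (p : N × ℝ) (v w : TangentSpace (I'.prod 𝓘(ℝ, ℝ)) p),
      G.val p v w = G.val p ((v.1, 0) : TangentSpace (I'.prod 𝓘(ℝ, ℝ)) p)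
        ((w.1, 0) : TangentSpace (I'.prod 𝓘(ℝ, ℝ)) p) + v.2 * w.2)
    (hstat : ∀ (z : N) (t t' : ℝ) (v w : E'),
      G.val (z, t) ((v, 0) : TangentSpace (I'.prod 𝓘(ℝ, ℝ)) (z, t))
          ((w, 0) : TangentSpace (I'.prod 𝓘(ℝ, ℝ)) (z, t)) =
        G.val (z, t') ((v, 0) : TangentSpace (I'.prod 𝓘(ℝ, ℝ)) (z, t'))
          ((w, 0) : TangentSpace (I'.prod 𝓘(ℝ, ℝ)) (z, t')))
    {F : N × ℝ → ℝ} (hF : ContMDiff (I'.prod 𝓘(ℝ, ℝ)) 𝓘(ℝ, ℝ) ∞ F)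
    (hsol : ∀ (p : N × ℝ) (X Y : TangentSpace (I'.prod 𝓘(ℝ, ℝ)) p),
      G.ricci p X Y + G.hessian F p X Y = (1 / 2 : ℝ) * G.val p X Y)
    (t : ℝ) (y : N) (v w : E') :
    haveI := (G.inducedMetric (fun y : N ↦ ((y, t) : N × ℝ))
      (contMDiff_pullbackBilin_holds (I := I'.prod 𝓘(ℝ, ℝ)) (M := N × ℝ) (I' := I') (N := N))
      (isSpacelikeImmersion_cylSlice G hG t)).hasLeviCivita
    (G.inducedMetric (fun y : N ↦ ((y, t) : N × ℝ))
        (contMDiff_pullbackBilin_holds (I := I'.prod 𝓘(ℝ, ℝ)) (M := N × ℝ) (I' := I') (N := N))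
        (isSpacelikeImmersion_cylSlice G hG t)).ricci y v w +
      (G.inducedMetric (fun y : N ↦ ((y, t) : N × ℝ))
        (contMDiff_pullbackBilin_holds (I := I'.prod 𝓘(ℝ, ℝ)) (M := N × ℝ) (I' := I') (N := N))
        (isSpacelikeImmersion_cylSlice G hG t)).hessian (fun y : N ↦ F (y, t)) y v w =
      (1 / 2 : ℝ) * (G.inducedMetric (fun y : N ↦ ((y, t) : N × ℝ))
        (contMDiff_pullbackBilin_holds (I := I'.prod 𝓘(ℝ, ℝ)) (M := N × ℝ) (I' := I') (N := N))
        (isSpacelikeImmersion_cylSlice G hG t)).val y v w := by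
  haveI := (G.inducedMetric (fun y : N ↦ ((y, t) : N × ℝ))
    (contMDiff_pullbackBilin_holds (I := I'.prod 𝓘(ℝ, ℝ)) (M := N × ℝ) (I' := I') (N := N))
    (isSpacelikeImmersion_cylSlice G hG t)).hasLeviCivita
  have hF2 : ContMDiff (I'.prod 𝓘(ℝ, ℝ)) 𝓘(ℝ, ℝ) 2 F := hF.of_le (by exact WithTop.coe_le_coe.2 le_top)
  rw [← staticCyl_ricci_inl_inl G hG hcyl hstat y t v w, staticCyl_hessian_slice G hG hcyl hstat hF2 y t v w,
    inducedMetric_val, inducedBilin_apply, mfderiv_cylSlice_apply, mfderiv_cylSlice_apply]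
  exact hsol ((y, t) : N × ℝ) _ _

/-- **Step 5 of the printed chain of `shrinkerSplittingAtInfinity_four`: a normalised gradient
shrinker on a static cylinder descends to a normalised gradient shrinker on the slice through
the critical level of the splitting direction.** If `(N × ℝ, G = h + dt², F)` is a connected static
Riemannian generalized cylinder with `Ric_G + Hess_G F = G/2` and `R_G + |∇F|²_G = F`, then there
is `t₀` such that `F(z, t) = φ(z) + (t - t₀)²/4` with `φ = F ∘ ι_{t₀}`, `∂_t F = (t - t₀)/2`, and
`(N, h = ι_{t₀}^*G, φ)` satisfies `Ric_h + Hess_h φ = h/2` and `R_h + |∇φ|²_h = φ`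
(`staticCyl_potential_split`, `staticCyl_slice_soliton`, `staticCyl_scalarCurvature_eq_slice`,
`cyl_gradSq_eq`). Haslhofer–Müller 2011, §2, p. 5 ("the potential has the form
`f(x, y) = f̃(x) + ¼|y - y₀|²`, … `(M̃, g̃, f̃)` is again a gradient shrinker, normalised");
Bertellotti–Buzano 2025, p. 26; Naber 2010, proof of Lemma 2.1. [cite: HaslhoferMuller2011, §2 (p. 5)] -/
theorem staticCyl_normalisedShrinker_slice [ConnectedSpace N] (hG : G.IsRiemannian)
    (hcyl : ∀ (p : N × ℝ) (v w : TangentSpace (I'.prod 𝓘(ℝ, ℝ)) p),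
      G.val p v w = G.val p ((v.1, 0) : TangentSpace (I'.prod 𝓘(ℝ, ℝ)) p)
        ((w.1, 0) : TangentSpace (I'.prod 𝓘(ℝ, ℝ)) p) + v.2 * w.2)
    (hstat : ∀ (z : N) (t t' : ℝ) (v w : E'),
      G.val (z, t) ((v, 0) : TangentSpace (I'.prod 𝓘(ℝ, ℝ)) (z, t))
          ((w, 0) : TangentSpace (I'.prod 𝓘(ℝ, ℝ)) (z, t)) =
        G.val (z, t') ((v, 0) : TangentSpace (I'.prod 𝓘(ℝ, ℝ)) (z, t'))
          ((w, 0) : TangentSpace (I'.prod 𝓘(ℝ, ℝ)) (z, t')))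
    {F : N × ℝ → ℝ} (hF : ContMDiff (I'.prod 𝓘(ℝ, ℝ)) 𝓘(ℝ, ℝ) ∞ F)
    (hsol : ∀ (p : N × ℝ) (X Y : TangentSpace (I'.prod 𝓘(ℝ, ℝ)) p),
      G.ricci p X Y + G.hessian F p X Y = (1 / 2 : ℝ) * G.val p X Y)
    (hnorm : ∀ p : N × ℝ, G.scalarCurvature p + G.gradSq F p = F p) :
    ∃ t₀ : ℝ,
      (∀ (z : N) (t : ℝ), F (z, t) = F (z, t₀) + (t - t₀) ^ 2 / 4) ∧
      (∀ (z : N) (t : ℝ), mvfderiv (I'.prod 𝓘(ℝ, ℝ)) F (z, t)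
        (((0 : E'), (1 : ℝ)) : TangentSpace (I'.prod 𝓘(ℝ, ℝ)) (z, t)) = (t - t₀) / 2) ∧
      (haveI := (G.inducedMetric (fun y : N ↦ ((y, t₀) : N × ℝ))
        (contMDiff_pullbackBilin_holds (I := I'.prod 𝓘(ℝ, ℝ)) (M := N × ℝ) (I' := I') (N := N))
        (isSpacelikeImmersion_cylSlice G hG t₀)).hasLeviCivita
      (∀ (y : N) (v w : E'),
        (G.inducedMetric (fun y : N ↦ ((y, t₀) : N × ℝ))
            (contMDiff_pullbackBilin_holds (I := I'.prod 𝓘(ℝ, ℝ)) (M := N × ℝ) (I' := I') (N := N))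
            (isSpacelikeImmersion_cylSlice G hG t₀)).ricci y v w +
          (G.inducedMetric (fun y : N ↦ ((y, t₀) : N × ℝ))
            (contMDiff_pullbackBilin_holds (I := I'.prod 𝓘(ℝ, ℝ)) (M := N × ℝ) (I' := I') (N := N))
            (isSpacelikeImmersion_cylSlice G hG t₀)).hessian (fun y : N ↦ F (y, t₀)) y v w =
          (1 / 2 : ℝ) * (G.inducedMetric (fun y : N ↦ ((y, t₀) : N × ℝ))
            (contMDiff_pullbackBilin_holds (I := I'.prod 𝓘(ℝ, ℝ)) (M := N × ℝ) (I' := I') (N := N))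
            (isSpacelikeImmersion_cylSlice G hG t₀)).val y v w) ∧
      (∀ y : N,
        (G.inducedMetric (fun y : N ↦ ((y, t₀) : N × ℝ))
            (contMDiff_pullbackBilin_holds (I := I'.prod 𝓘(ℝ, ℝ)) (M := N × ℝ) (I' := I') (N := N))
            (isSpacelikeImmersion_cylSlice G hG t₀)).scalarCurvature y +
          (G.inducedMetric (fun y : N ↦ ((y, t₀) : N × ℝ))
            (contMDiff_pullbackBilin_holds (I := I'.prod 𝓘(ℝ, ℝ)) (M := N × ℝ) (I' := I') (N := N))
            (isSpacelikeImmersion_cylSlice G hG t₀)).gradSq (fun y : N ↦ F (y, t₀)) y = F (y, t₀))) := by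
  obtain ⟨t₀, hu, hsplit⟩ := staticCyl_potential_split G hG hcyl hstat hF hsol
  refine ⟨t₀, hsplit, hu, fun y v w ↦ staticCyl_slice_soliton G hG hcyl hstat hF hsol t₀ y v w,
    fun y ↦ ?_⟩
  haveI := (G.inducedMetric (fun y : N ↦ ((y, t₀) : N × ℝ))
    (contMDiff_pullbackBilin_holds (I := I'.prod 𝓘(ℝ, ℝ)) (M := N × ℝ) (I' := I') (N := N))
    (isSpacelikeImmersion_cylSlice G hG t₀)).hasLeviCivita
  have hR := staticCyl_scalarCurvature_eq_slice G hG hcyl hstat y t₀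
  have hQ := cyl_gradSq_eq G hG hcyl (F := F) (z := y) (t := t₀) ((hF _).mdifferentiableAt (by simp))
  have hn := hnorm ((y, t₀) : N × ℝ)
  rw [hR, hQ, hu y t₀, sub_self, zero_div] at hn
  simpa using hn

end Literature.Geometry.Riemannian

end
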